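import Literature.Barriers.NavierStokesRegularity.ComplexNavierStokesBlowupSeriesSingularTime
import Mathlib.Analysis.PSeries
import Mathlib.Analysis.SpecificLimits.Normed
import Mathlib.MeasureTheory.Measure.Haar.InnerProductSpace
import HarnessLib

/-!
# Li–Sinai complex Navier–Stokes blow-up: infinite energy AT the critical time from the profile of the coefficients (§10)

Ninth file of the barrier entry `ComplexNavierStokesBlowup` (D-0021), companion of
`ComplexNavierStokesBlowupSeries.lean` (the power series (3) of D. Li, Ya. G. Sinai, *Blow ups of
complex solutions of the 3D Navier–Stokes system and renormalization group method*, J. Eur. Math.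
Soc. 10 (2008) 267–313, §2, PROVED there to solve the integral equation (1) at all times; the
named fact `LiSinaiSeriesEnergyBlowup` = finite energy of the series on `[0, t)`, infinite AT
`t`, for one admissible datum — the unproved core behind the catalogued barrier) and of
`ComplexNavierStokesBlowupSeriesSingularTime.lean` (`LiSinaiSeriesEnergyBlowup.of_infinite_of_
modeDecay`: the second paragraph of §10, "for `t' < t` … finite", made honest — geometric decay
of the terms at every `τ < t` plus infinite energy at `t` give the fact). Everything in this
file is PROVED; no new fact is stated (the two `def`s are Li–Sinai's inner coefficients `g_p`
and their windows, with bodies). (Fourier space is `EuclideanSpace ℝ (Fin 3)`; `k 2` is the third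
coordinate `k₃`, the vertical direction of `κ⁽⁰⁾ = (0, 0, k⁽⁰⁾)`; `mode v₀ p t` is the `p`-th
term of (3)/(46) at time `t`, amplitude absorbed into the datum.)

## What the source does in §10 (p. 312) and what is formalised here

Theorem 1 p. 311 gives, for the 10-parameter data (39) tuned to the stable manifold of the
Gaussian–Hermite fixed point `H⁽⁰⁾ = (-2Y₁, -2Y₂, 0)·` (Case 2 p. 276, §7 p. 295), the
asymptotics of the COEFFICIENTS `g_p(k, s)` of (3) — not of the terms
`∫₀ᵗ e^{-(t-s)|k|²} g_p(k, s) ds` — in the window `k = K⁽ᵖ⁾ + √(p k⁽⁰⁾) Y`, `K⁽ᵖ⁾ = (0,0,pk⁽⁰⁾)`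
(p. 270): `g̃_p(Y, s) = p Z(s) Λ(s)^p e^{-|Y|²/2} (H⁽⁰⁾(Y₁,Y₂) + δ⁽ᵖ⁾(Y, s))`,
`sup |δ⁽ᵖ⁾| → 0`, `Λ` strictly increasing (Thm. 1 (a₁) p. 311–312). §10 then takes
`A_cr(t) = Λ(t)⁻¹` and says: "`A^p g_p(k, t)` is concentrated in the domain with center `K⁽ᵖ⁾`
having the size `O(√p)` and there it takes values `O(p)`. This immediately implies that at `t`
the energy is infinite." The implication is NOT a size count: about `√p` consecutive terms
overlap at each wave vector of the `p`-th window, and terms of different orders could cancel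
(sizes alone give infinite energy only for SOME amplitude — `ComplexNavierStokesBlowupSeriesRate
.lean` — whereas the barrier needs it at the amplitude for which all earlier times are finite).
What makes §10 work is the SIGN structure of `H⁽⁰⁾`: on `{Y₁ > 0}` all overlapping terms have
first component of the sign of `-2Y₁ < 0`. This file proves that mechanism and packages §10 as
an honest implication from Theorem-1-shaped hypotheses on the explicit recursion (5)–(6):

* `LiSinai.coeff v₀ p s k` = `g_p(k, s)` of (5)–(6) (`p ≥ 2`), with `mode v₀ p (t,k) =
  ∫₀ᵗ e^{-(t-s)|k|²} g_p(k,s) ds` (`LiSinai.mode_eq_integral_coeff`; interval integrability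
  from `mode_bound`, `mode_support`) and its scalar form `LiSinai.inner_mode_eq_integral`.
* One-term estimates (`LiSinai.inner_mode_le_of_sign`, `LiSinai.inner_mode_le_of_lower`): a
  bound `‖g_p‖ ≤ B` on `[0, b]`, a sign `⟨e, g_p⟩ ≤ 0` on `[b, t]` and a lower bound
  `⟨e, g_p⟩ ≤ -L` on the final window `[t - δ, t]`, `δ|k|² ≤ 1` (heat factor `≥ e⁻¹` there),
  give `⟨e, mode v₀ p (t,k)⟩ ≤ b|e|B - δ e⁻¹ L`; and `LiSinai.exists_modeDecay_of_coeffBound`: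
  geometric bounds of the coefficients on `[0, τ]` give geometric decay of all terms at `τ`.
* `LiSinai.energy_eq_top_of_signedModes` (**the mechanism**): if on a measurable `G` the
  positive parts of `x_p = ⟨e, mode v₀ p (t, ·)⟩` satisfy `Σ_p x_p⁺ ≤ F`, `∫_G F² < ∞`, and the
  negative parts `Σ_p ∫_G (x_p⁻)² = ∞`, then `∫ |seriesSolution v₀ (t,k)|² dk = ∞`
  (`Σ (x_p⁻)² ≤ (Σ x_p⁻)² ≤ 2F² + 2|e|²|v|²`, Tonelli).
* `LiSinai.energy_eq_top_of_coeffProfile` (**§10, first paragraph**): for an admissible datum,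
  `t ≥ η > 0`, cores `Core p ⊆ G` with `c₀p ≤ |k| ≤ c₁p`, `vol ≥ κp`: early smallness
  `‖g_p(k,s)‖ ≤ Cρ^p` (`ρ < 1`) on `[0, t-η]`, sign `⟨e, g_p(k,s)⟩ ≤ 0` on `G` for
  `s ∈ [t-η, t]`, `p ≥ p*`, and size `⟨e, g_p(k,s)⟩ ≤ -cp` on `Core p` for `s` in
  `[t-η, t] ∩ [t - 1/|k|², t]` imply infinite energy at `t` (negative parts `≥ d/p` on the
  cores, `Σ_p (d/p)² κ p = ∞`; positive parts `≤ t|e|Cρ^p 1_{|k| ≤ p|R|}`, square integrable).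
* `LiSinaiSeriesEnergyBlowup.of_coeffProfile`, `ComplexNavierStokesBlowup.of_coeffProfile`
  (**§10, both paragraphs**): adding geometric bounds of ratio `< 1` on `[0, τ]` for every
  `τ < t` (the second paragraph) gives the energy-profile fact and the catalogued barrier.
* The windows of Theorem 1 (a₁) as cores: `LiSinai.lsCore k₀ p = K⁽ᵖ⁾ + √(pk₀)([1,2]×[-1,1]²)`
  (`measurableSet_lsCore`, `volume_lsCore` = `4x√x`, `x = pk₀`, `le_volume_lsCore`,
  `norm_bounds_of_mem_lsCore`, `sq_apply_zero_ge_of_mem_lsCore`), and the assembled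
  `ComplexNavierStokesBlowup.of_liSinaiWindows`: the barrier from (U) sub-criticality before
  `t`, (S) the sign of `⟨e₁, g_p⟩` on the union of the windows near `t`, (L) `⟨e₁, g_p⟩ ≤ -cp`
  on the `p`-th window near `t` — the three things §10 takes from Theorem 1.

So after this file nothing of §10 is informal: for the barrier, the Theorem-1 input of the
source is exactly (U) ∧ (S) ∧ (L) for ONE admissible datum. None of (U), (S), (L) is proved
here or anywhere in the tree: they are the content of Theorem 1 (a renormalisation-group theorem
whose proof has computer-assisted steps, §7 p. 295 "our numerical studies show", p. 302 "for all
`p ≤ 50` all remainders were found numerically"), and (U) concerns the `t`-critical datum at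
earlier times, which Theorem 1, stated for `s`-dependent parameter values `b(s)`, does not
literally cover (audit in `ComplexNavierStokesBlowupProofs.lean`). `ComplexNavierStokesBlowup_
holds` is therefore NOT provided.

## References

* D. Li, Ya. G. Sinai, J. Eur. Math. Soc. 10 (2008) 267–313: §2 p. 269–270 (eqs. (3)–(6),
  `K⁽ʳ⁾`, `Y`), §4 p. 276 (Case 2), §7 p. 295 (`H₁ = -2Y₁, H₂ = -2Y₂`; data (39)), p. 302
  (numerics), Thm. 1 p. 311–312, §10 p. 312 (eq. (46), `A_cr`, the two paragraphs).
  [`LiSinai2008`]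
-/

noncomputable section

open MeasureTheory Set Filter Topology Finset
open scoped ENNReal InnerProductSpace RealInnerProductSpace BigOperators

namespace Literature.Barriers.NavierStokesRegularity

/-- Local notation for Fourier space `ℝ³ = EuclideanSpace ℝ (Fin 3)`; `k 2` is the third
coordinate `k₃`. -/
local notation "ℝ³" => EuclideanSpace ℝ (Fin 3)

namespace LiSinai

/-! ### Li–Sinai's inner coefficients `g_p(k, s)` of (5)–(6) -/

/-- **Li–Sinai's coefficients `g_p(k, s)`** of the power series (3)/(46), i.e. the INNER
(not yet time-integrated) Duhamel coefficients of eqs. (5)–(6): for `p = m + 2 ≥ 2`,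
`coeff v₀ (m+2) s k = Σ_{p₁ + p₂ = p, p₁, p₂ ≥ 1} ∫ ⟨mode v₀ p₁ (s, k - k'), k⟩ P_k mode v₀ p₂ (s, k') dk'`,
so that `mode v₀ p (t, k) = ∫₀ᵗ e^{-(t-s)|k|²} coeff v₀ p (s, k) ds` (`mode_eq_integral_coeff`),
which is exactly the way `g_p` enters (3)/(46) (`v_A(k,t) = e^{-t|k|²} A v(k,0) + ∫₀ᵗ
e^{-(t-s)|k|²} Σ_{p>1} A^p g_p(k,s) ds`). The free term `p = 1` of (3) is not of this form and
`coeff v₀ 1 := 0`, `coeff v₀ 0 := 0` (bookkeeping; amplitude absorbed into the datum as in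
`mode`, so `g_p` of the datum `A v₀` is `A^p coeff v₀ p`). Theorem 1 of the source (p. 311) is a
statement about these coefficients (`g̃_p(Y, s) = g_p(K⁽ᵖ⁾ + √(p k⁽⁰⁾) Y, s)`).
[cite: LiSinai2008, §2 eqs. (3)–(6) p. 269; §10 eq. (46) p. 312] -/
def coeff (v₀ : ℝ³ → ℝ³) : ℕ → ℝ → ℝ³ → ℝ³
  | 0 => fun _ _ => 0
  | 1 => fun _ _ => 0
  | m + 2 => fun s k => ∑ i : Fin (m + 1),
      ∫ k', pairIntegrand (mode v₀ (i.1 + 1)) (mode v₀ (m - i.1 + 1)) k s k'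

/-- Bookkeeping: `coeff v₀ 0 = 0`. [folklore] -/
theorem coeff_zero (v₀ : ℝ³ → ℝ³) (s : ℝ) (k : ℝ³) : coeff v₀ 0 s k = 0 := rfl

/-- Bookkeeping: `coeff v₀ 1 = 0` (the first term of (3) is the free heat evolution, not a
Duhamel integral). [folklore] -/
theorem coeff_one (v₀ : ℝ³ → ℝ³) (s : ℝ) (k : ℝ³) : coeff v₀ 1 s k = 0 := rfl

/-- The recursion (5)–(6): `g_{m+2}(k,s) = Σ_{p₁+p₂=m+2} ∫ ⟨mode p₁ (s,k-k'),k⟩ P_k mode p₂ (s,k')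
dk'`. [cite: LiSinai2008, §2 eqs. (5)–(6) p. 269] -/
theorem coeff_add_two (v₀ : ℝ³ → ℝ³) (m : ℕ) (s : ℝ) (k : ℝ³) :
    coeff v₀ (m + 2) s k = ∑ i : Fin (m + 1),
      ∫ k', pairIntegrand (mode v₀ (i.1 + 1)) (mode v₀ (m - i.1 + 1)) k s k' := rfl

/-- Interval integrability on `[0, t]`, `t ≥ 0`, of the Duhamel time integrand of a pair of modes
of an admissible datum (bounded measurable, vanishing off `{a ≤ k₃, |k| ≤ R}`): the modes are
locally bounded (`mode_bound`) and supported in balls (`mode_support`). [folklore] -/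
theorem intervalIntegrable_modePairIntegrand {v₀ : ℝ³ → ℝ³} {a R M₀ : ℝ}
    (hv₀m : Measurable v₀) (hv₀ : ∀ k, v₀ k ≠ 0 → a ≤ k 2 ∧ ‖k‖ ≤ R) (hM₀ : ∀ k, ‖v₀ k‖ ≤ M₀)
    {t : ℝ} (ht : 0 ≤ t) (p q : ℕ) (k : ℝ³) :
    IntervalIntegrable (fun s => Real.exp (-(t - s) * ‖k‖ ^ 2) •
      ∫ k', pairIntegrand (mode v₀ p) (mode v₀ q) k s k') volume 0 t := by
  obtain ⟨M, -, hM⟩ := mode_bound hv₀ hM₀ t (max p q)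
  have hGs : ∀ s ∈ Icc 0 t, ∀ k', mode v₀ q s k' ≠ 0 → ‖k'‖ ≤ (q : ℝ) * |R| := by
    intro s _ k' hk'
    exact (mode_support hv₀ q s k' hk').2.trans
      (mul_le_mul_of_nonneg_left (le_abs_self R) (by positivity))
  exact intervalIntegrable_duhamelIntegrand (measurable_mode hv₀m p) (measurable_mode hv₀m q)
    (hM p (le_max_left _ _)) (hM q (le_max_right _ _)) hGs ⟨ht, le_rfl⟩ k

/-- Interval integrability on `[0, t]`, `t ≥ 0`, of the time integrand
`e^{-(t-s)|k|²} g_{m+2}(k, s)` of the `(m+2)`-nd term of (3). [folklore] -/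
theorem intervalIntegrable_coeffIntegrand {v₀ : ℝ³ → ℝ³} {a R M₀ : ℝ}
    (hv₀m : Measurable v₀) (hv₀ : ∀ k, v₀ k ≠ 0 → a ≤ k 2 ∧ ‖k‖ ≤ R) (hM₀ : ∀ k, ‖v₀ k‖ ≤ M₀)
    {t : ℝ} (ht : 0 ≤ t) (m : ℕ) (k : ℝ³) :
    IntervalIntegrable (fun s => Real.exp (-(t - s) * ‖k‖ ^ 2) • coeff v₀ (m + 2) s k)
      volume 0 t := by
  have heq : (fun s => Real.exp (-(t - s) * ‖k‖ ^ 2) • coeff v₀ (m + 2) s k) =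
      ∑ i : Fin (m + 1), fun s => Real.exp (-(t - s) * ‖k‖ ^ 2) •
        ∫ k', pairIntegrand (mode v₀ (i.1 + 1)) (mode v₀ (m - i.1 + 1)) k s k' := by
    funext s
    rw [coeff_add_two, Finset.smul_sum, Finset.sum_apply]
  rw [heq]
  exact IntervalIntegrable.sum _ fun i _ =>
    intervalIntegrable_modePairIntegrand hv₀m hv₀ hM₀ ht _ _ k

/-- **The terms of (3) are the heat-Duhamel integrals of Li–Sinai's coefficients**: for an
admissible datum, `t ≥ 0` and `p = m + 2 ≥ 2`,
`mode v₀ p (t, k) = ∫₀ᵗ e^{-(t-s)|k|²} g_p(k, s) ds` — eq. (3)/(46) term by term (finitely many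
exchanges of a finite sum with an honest interval integral). [cite: LiSinai2008, §2 eq. (3)
p. 269; §10 eq. (46) p. 312] -/
theorem mode_eq_integral_coeff {v₀ : ℝ³ → ℝ³} {a R M₀ : ℝ}
    (hv₀m : Measurable v₀) (hv₀ : ∀ k, v₀ k ≠ 0 → a ≤ k 2 ∧ ‖k‖ ≤ R) (hM₀ : ∀ k, ‖v₀ k‖ ≤ M₀)
    {t : ℝ} (ht : 0 ≤ t) (m : ℕ) (k : ℝ³) :
    mode v₀ (m + 2) t k =
      ∫ s in (0 : ℝ)..t, Real.exp (-(t - s) * ‖k‖ ^ 2) • coeff v₀ (m + 2) s k := by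
  rw [mode_add_two]
  simp_rw [coeff_add_two, Finset.smul_sum]
  rw [intervalIntegral.integral_finsetSum fun i _ =>
    intervalIntegrable_modePairIntegrand hv₀m hv₀ hM₀ ht _ _ k]
  rfl

/-- Scalar form of `mode_eq_integral_coeff`: for every direction `e`,
`⟨e, mode v₀ p (t,k)⟩ = ∫₀ᵗ e^{-(t-s)|k|²} ⟨e, g_p(k,s)⟩ ds` (`p ≥ 2`, `t ≥ 0`). [folklore] -/
theorem inner_mode_eq_integral {v₀ : ℝ³ → ℝ³} {a R M₀ : ℝ}
    (hv₀m : Measurable v₀) (hv₀ : ∀ k, v₀ k ≠ 0 → a ≤ k 2 ∧ ‖k‖ ≤ R) (hM₀ : ∀ k, ‖v₀ k‖ ≤ M₀)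
    {t : ℝ} (ht : 0 ≤ t) (m : ℕ) (k e : ℝ³) :
    ⟪e, mode v₀ (m + 2) t k⟫ =
      ∫ s in (0 : ℝ)..t, Real.exp (-(t - s) * ‖k‖ ^ 2) * ⟪e, coeff v₀ (m + 2) s k⟫ := by
  rw [mode_eq_integral_coeff hv₀m hv₀ hM₀ ht m k, ← innerSL_apply_apply (𝕜 := ℝ),
    ← ContinuousLinearMap.intervalIntegral_comp_comm _
      (intervalIntegrable_coeffIntegrand hv₀m hv₀ hM₀ ht m k)]
  congr 1
  funext s
  rw [innerSL_apply_apply, real_inner_smul_right]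

/-- Interval integrability, on every subinterval `[c, d] ⊆ [0, t]`, of the scalar time integrand
`e^{-(t-s)|k|²} ⟨e, g_p(k,s)⟩` (`p ≥ 2`, `t ≥ 0`). [folklore] -/
theorem intervalIntegrable_inner_coeffIntegrand {v₀ : ℝ³ → ℝ³} {a R M₀ : ℝ}
    (hv₀m : Measurable v₀) (hv₀ : ∀ k, v₀ k ≠ 0 → a ≤ k 2 ∧ ‖k‖ ≤ R) (hM₀ : ∀ k, ‖v₀ k‖ ≤ M₀)
    {t : ℝ} (ht : 0 ≤ t) (m : ℕ) (k e : ℝ³) {c d : ℝ} (hc : c ∈ Icc 0 t) (hd : d ∈ Icc 0 t) :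
    IntervalIntegrable
      (fun s => Real.exp (-(t - s) * ‖k‖ ^ 2) * ⟪e, coeff v₀ (m + 2) s k⟫) volume c d := by
  have hV := intervalIntegrable_coeffIntegrand hv₀m hv₀ hM₀ ht m k
  have heq : (fun s => (innerSL ℝ e) (Real.exp (-(t - s) * ‖k‖ ^ 2) • coeff v₀ (m + 2) s k)) =
      fun s => Real.exp (-(t - s) * ‖k‖ ^ 2) * ⟪e, coeff v₀ (m + 2) s k⟫ := by
    funext s
    rw [innerSL_apply_apply, real_inner_smul_right]
  have h0t : IntervalIntegrable
      (fun s => Real.exp (-(t - s) * ‖k‖ ^ 2) * ⟪e, coeff v₀ (m + 2) s k⟫) volume 0 t := by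
    rw [← heq]
    exact intervalIntegrable_iff.2 ((innerSL ℝ e).integrable_comp (intervalIntegrable_iff.1 hV))
  refine h0t.mono_set ?_
  rw [uIcc_of_le ht]
  exact uIcc_subset_Icc hc hd

/-! ### Estimates of the time integral from bounds, signs and lower bounds of the coefficients -/

/-- On `[c, d]`, `c ≤ d ≤ t`, a bound `‖g_p(k, s)‖ ≤ B` gives `∫_c^d e^{-(t-s)|k|²}⟨e, g_p(k,s)⟩ ds ≤
(d - c) |e| B` (heat factor `≤ 1`). [folklore] -/
theorem integral_inner_coeff_le_of_bound {v₀ : ℝ³ → ℝ³}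
    {t c d : ℝ} (hcd : c ≤ d) (hdt : d ≤ t) (m : ℕ) (k e : ℝ³) {B : ℝ}
    (hB : ∀ s ∈ Icc c d, ‖coeff v₀ (m + 2) s k‖ ≤ B) :
    ∫ s in c..d, Real.exp (-(t - s) * ‖k‖ ^ 2) * ⟪e, coeff v₀ (m + 2) s k⟫ ≤
      (d - c) * (‖e‖ * B) := by
  have hbound : ∀ s ∈ Set.uIoc c d,
      ‖Real.exp (-(t - s) * ‖k‖ ^ 2) * ⟪e, coeff v₀ (m + 2) s k⟫‖ ≤ ‖e‖ * B := by
    intro s hs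
    rw [uIoc_of_le hcd] at hs
    have hs' : s ∈ Icc c d := ⟨hs.1.le, hs.2⟩
    rw [norm_mul, Real.norm_eq_abs, abs_of_pos (Real.exp_pos _)]
    have hexp : Real.exp (-(t - s) * ‖k‖ ^ 2) ≤ 1 := by
      rw [Real.exp_le_one_iff]
      nlinarith [hs.2, hdt, sq_nonneg ‖k‖]
    have hin : ‖⟪e, coeff v₀ (m + 2) s k⟫‖ ≤ ‖e‖ * B :=
      (norm_inner_le_norm _ _).trans (mul_le_mul_of_nonneg_left (hB s hs') (norm_nonneg _))
    calc Real.exp (-(t - s) * ‖k‖ ^ 2) * ‖⟪e, coeff v₀ (m + 2) s k⟫‖ ≤ 1 * (‖e‖ * B) :=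
          mul_le_mul hexp hin (norm_nonneg _) zero_le_one
      _ = ‖e‖ * B := one_mul _
  calc ∫ s in c..d, Real.exp (-(t - s) * ‖k‖ ^ 2) * ⟪e, coeff v₀ (m + 2) s k⟫
      ≤ ‖∫ s in c..d, Real.exp (-(t - s) * ‖k‖ ^ 2) * ⟪e, coeff v₀ (m + 2) s k⟫‖ :=
        Real.le_norm_self _
    _ ≤ (‖e‖ * B) * |d - c| := intervalIntegral.norm_integral_le_of_norm_le_const hbound
    _ = (d - c) * (‖e‖ * B) := by rw [abs_of_nonneg (sub_nonneg.2 hcd), mul_comm]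

/-- On `[c, d]`, `c ≤ d`, a sign `⟨e, g_p(k,s)⟩ ≤ 0` gives `∫_c^d e^{-(t-s)|k|²}⟨e, g_p(k,s)⟩ ds ≤ 0`.
[folklore] -/
theorem integral_inner_coeff_nonpos {v₀ : ℝ³ → ℝ³} {t c d : ℝ} (hcd : c ≤ d) (m : ℕ)
    (k e : ℝ³) (hsign : ∀ s ∈ Icc c d, ⟪e, coeff v₀ (m + 2) s k⟫ ≤ 0) :
    ∫ s in c..d, Real.exp (-(t - s) * ‖k‖ ^ 2) * ⟪e, coeff v₀ (m + 2) s k⟫ ≤ 0 := by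
  have hneg : 0 ≤ ∫ s in c..d, -(Real.exp (-(t - s) * ‖k‖ ^ 2) * ⟪e, coeff v₀ (m + 2) s k⟫) :=
    intervalIntegral.integral_nonneg hcd fun s hs =>
      neg_nonneg.2 (mul_nonpos_of_nonneg_of_nonpos (Real.exp_pos _).le (hsign s hs))
  rw [intervalIntegral.integral_neg] at hneg
  linarith

/-- On the final window `[t - δ, t]` with `δ |k|² ≤ 1` (so that the heat factor is `≥ e⁻¹`
there), a lower bound `⟨e, g_p(k,s)⟩ ≤ -L ≤ 0` gives
`∫_{t-δ}^t e^{-(t-s)|k|²}⟨e, g_p(k,s)⟩ ds ≤ -δ e⁻¹ L`. [folklore] -/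
theorem integral_inner_coeff_le_of_lower {v₀ : ℝ³ → ℝ³} {a R M₀ : ℝ}
    (hv₀m : Measurable v₀) (hv₀ : ∀ k, v₀ k ≠ 0 → a ≤ k 2 ∧ ‖k‖ ≤ R) (hM₀ : ∀ k, ‖v₀ k‖ ≤ M₀)
    {t δ : ℝ} (hδ : 0 < δ) (hδt : δ ≤ t) (m : ℕ) (k e : ℝ³) {L : ℝ} (hL : 0 ≤ L)
    (hlow : ∀ s ∈ Icc (t - δ) t, ⟪e, coeff v₀ (m + 2) s k⟫ ≤ -L) (hδk : δ * ‖k‖ ^ 2 ≤ 1) :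
    ∫ s in (t - δ)..t, Real.exp (-(t - s) * ‖k‖ ^ 2) * ⟪e, coeff v₀ (m + 2) s k⟫ ≤
      -(δ * (Real.exp (-1) * L)) := by
  have ht : 0 ≤ t := hδ.le.trans hδt
  have htδ : 0 ≤ t - δ := sub_nonneg.2 hδt
  have hle : t - δ ≤ t := by linarith
  have hI := intervalIntegrable_inner_coeffIntegrand hv₀m hv₀ hM₀ ht m k e ⟨htδ, hle⟩ ⟨ht, le_rfl⟩
  have hpt : ∀ s ∈ Icc (t - δ) t,
      Real.exp (-(t - s) * ‖k‖ ^ 2) * ⟪e, coeff v₀ (m + 2) s k⟫ ≤ Real.exp (-1) * (-L) := by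
    intro s hs
    have hg := hlow s hs
    have hexp1 : Real.exp (-1) ≤ Real.exp (-(t - s) * ‖k‖ ^ 2) := by
      rw [Real.exp_le_exp]
      have h1 : t - s ≤ δ := by linarith [hs.1]
      have h2 : 0 ≤ t - s := by linarith [hs.2]
      nlinarith [sq_nonneg ‖k‖, mul_le_mul_of_nonneg_right h1 (sq_nonneg ‖k‖)]
    calc Real.exp (-(t - s) * ‖k‖ ^ 2) * ⟪e, coeff v₀ (m + 2) s k⟫
        ≤ Real.exp (-(t - s) * ‖k‖ ^ 2) * (-L) :=
          mul_le_mul_of_nonneg_left hg (Real.exp_pos _).le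
      _ ≤ Real.exp (-1) * (-L) := mul_le_mul_of_nonpos_right hexp1 (neg_nonpos.2 hL)
  calc ∫ s in (t - δ)..t, Real.exp (-(t - s) * ‖k‖ ^ 2) * ⟪e, coeff v₀ (m + 2) s k⟫
      ≤ ∫ _ in (t - δ)..t, Real.exp (-1) * (-L) :=
        intervalIntegral.integral_mono_on hle hI intervalIntegrable_const hpt
    _ = -(δ * (Real.exp (-1) * L)) := by
        rw [intervalIntegral.integral_const, smul_eq_mul]
        ring

/-- **Upper bound for a term of (3) from the sizes and signs of its coefficient**: if on `[0, b]`
(`0 ≤ b ≤ t`) `‖g_p(k,s)‖ ≤ B` and on `[b, t]` `⟨e, g_p(k,s)⟩ ≤ 0`, then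
`⟨e, mode v₀ p (t,k)⟩ ≤ b |e| B` (`p ≥ 2`). [folklore] -/
theorem inner_mode_le_of_sign {v₀ : ℝ³ → ℝ³} {a R M₀ : ℝ}
    (hv₀m : Measurable v₀) (hv₀ : ∀ k, v₀ k ≠ 0 → a ≤ k 2 ∧ ‖k‖ ≤ R) (hM₀ : ∀ k, ‖v₀ k‖ ≤ M₀)
    {t b : ℝ} (hb0 : 0 ≤ b) (hbt : b ≤ t) (m : ℕ) (k e : ℝ³) {B : ℝ}
    (hB : ∀ s ∈ Icc 0 b, ‖coeff v₀ (m + 2) s k‖ ≤ B)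
    (hsign : ∀ s ∈ Icc b t, ⟪e, coeff v₀ (m + 2) s k⟫ ≤ 0) :
    ⟪e, mode v₀ (m + 2) t k⟫ ≤ b * (‖e‖ * B) := by
  have ht : 0 ≤ t := hb0.trans hbt
  have hI : ∀ {c d : ℝ}, c ∈ Icc 0 t → d ∈ Icc 0 t → IntervalIntegrable
      (fun s => Real.exp (-(t - s) * ‖k‖ ^ 2) * ⟪e, coeff v₀ (m + 2) s k⟫) volume c d :=
    fun hc hd => intervalIntegrable_inner_coeffIntegrand hv₀m hv₀ hM₀ ht m k e hc hd
  rw [inner_mode_eq_integral hv₀m hv₀ hM₀ ht m k e,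
    ← intervalIntegral.integral_add_adjacent_intervals (hI ⟨le_rfl, ht⟩ ⟨hb0, hbt⟩)
      (hI ⟨hb0, hbt⟩ ⟨ht, le_rfl⟩)]
  have h1 := integral_inner_coeff_le_of_bound (t := t) hb0 hbt m k e hB
  have h2 := integral_inner_coeff_nonpos (v₀ := v₀) (t := t) hbt m k e hsign
  rw [sub_zero] at h1
  linarith

/-- **Upper bound for a term of (3) at the critical time from the profile of its coefficient**
(the quantitative content of §10, first paragraph, for ONE term): if on `[0, b]` `‖g_p(k,s)‖ ≤ B`,
on `[b, t]` `⟨e, g_p(k,s)⟩ ≤ 0`, and on the final window `[t - δ, t] ⊆ [b, t]` with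
`δ|k|² ≤ 1` moreover `⟨e, g_p(k,s)⟩ ≤ -L ≤ 0`, then
`⟨e, mode v₀ p (t,k)⟩ ≤ b |e| B - δ e⁻¹ L` (`p ≥ 2`). [cite: LiSinai2008, §10 p. 312] -/
theorem inner_mode_le_of_lower {v₀ : ℝ³ → ℝ³} {a R M₀ : ℝ}
    (hv₀m : Measurable v₀) (hv₀ : ∀ k, v₀ k ≠ 0 → a ≤ k 2 ∧ ‖k‖ ≤ R) (hM₀ : ∀ k, ‖v₀ k‖ ≤ M₀)
    {t b δ : ℝ} (hb0 : 0 ≤ b) (hδ : 0 < δ) (hbδ : b ≤ t - δ) (m : ℕ) (k e : ℝ³) {B L : ℝ}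
    (hB : ∀ s ∈ Icc 0 b, ‖coeff v₀ (m + 2) s k‖ ≤ B)
    (hsign : ∀ s ∈ Icc b t, ⟪e, coeff v₀ (m + 2) s k⟫ ≤ 0) (hL : 0 ≤ L)
    (hlow : ∀ s ∈ Icc (t - δ) t, ⟪e, coeff v₀ (m + 2) s k⟫ ≤ -L) (hδk : δ * ‖k‖ ^ 2 ≤ 1) :
    ⟪e, mode v₀ (m + 2) t k⟫ ≤ b * (‖e‖ * B) - δ * (Real.exp (-1) * L) := by
  have hδt' : t - δ ≤ t := by linarith
  have hbt : b ≤ t := hbδ.trans hδt'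
  have ht : 0 ≤ t := hb0.trans hbt
  have htδ0 : 0 ≤ t - δ := hb0.trans hbδ
  have hI : ∀ {c d : ℝ}, c ∈ Icc 0 t → d ∈ Icc 0 t → IntervalIntegrable
      (fun s => Real.exp (-(t - s) * ‖k‖ ^ 2) * ⟪e, coeff v₀ (m + 2) s k⟫) volume c d :=
    fun hc hd => intervalIntegrable_inner_coeffIntegrand hv₀m hv₀ hM₀ ht m k e hc hd
  rw [inner_mode_eq_integral hv₀m hv₀ hM₀ ht m k e,
    ← intervalIntegral.integral_add_adjacent_intervals (hI ⟨le_rfl, ht⟩ ⟨hb0, hbt⟩)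
      (hI ⟨hb0, hbt⟩ ⟨ht, le_rfl⟩),
    ← intervalIntegral.integral_add_adjacent_intervals (hI ⟨hb0, hbt⟩ ⟨htδ0, hδt'⟩)
      (hI ⟨htδ0, hδt'⟩ ⟨ht, le_rfl⟩)]
  have h1 := integral_inner_coeff_le_of_bound (t := t) hb0 hbt m k e hB
  have h2 := integral_inner_coeff_nonpos (v₀ := v₀) (t := t) hbδ m k e
    fun s hs => hsign s ⟨hs.1, hs.2.trans hδt'⟩
  have h3 := integral_inner_coeff_le_of_lower hv₀m hv₀ hM₀ hδ (by linarith) m k e hL hlow hδk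
  rw [sub_zero] at h1
  linarith

/-- Crude bound of a term of (3) from a bound of its coefficient: `‖g_p(k,s)‖ ≤ B` on `[0, t]`
gives `‖mode v₀ p (t,k)‖ ≤ t B` (`p ≥ 2`, `t ≥ 0`). [folklore] -/
theorem norm_mode_le_of_coeff_bound {v₀ : ℝ³ → ℝ³} {a R M₀ : ℝ}
    (hv₀m : Measurable v₀) (hv₀ : ∀ k, v₀ k ≠ 0 → a ≤ k 2 ∧ ‖k‖ ≤ R) (hM₀ : ∀ k, ‖v₀ k‖ ≤ M₀)
    {t : ℝ} (ht : 0 ≤ t) (m : ℕ) (k : ℝ³) {B : ℝ}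
    (hB : ∀ s ∈ Icc 0 t, ‖coeff v₀ (m + 2) s k‖ ≤ B) : ‖mode v₀ (m + 2) t k‖ ≤ t * B := by
  rw [mode_eq_integral_coeff hv₀m hv₀ hM₀ ht m k]
  have hbound : ∀ s ∈ Set.uIoc (0 : ℝ) t,
      ‖Real.exp (-(t - s) * ‖k‖ ^ 2) • coeff v₀ (m + 2) s k‖ ≤ B := by
    intro s hs
    rw [uIoc_of_le ht] at hs
    rw [norm_smul, Real.norm_eq_abs, abs_of_pos (Real.exp_pos _)]
    have hexp : Real.exp (-(t - s) * ‖k‖ ^ 2) ≤ 1 := by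
      rw [Real.exp_le_one_iff]
      nlinarith [hs.2, sq_nonneg ‖k‖]
    calc Real.exp (-(t - s) * ‖k‖ ^ 2) * ‖coeff v₀ (m + 2) s k‖ ≤ 1 * B :=
          mul_le_mul hexp (hB s ⟨hs.1.le, hs.2⟩) (norm_nonneg _) zero_le_one
      _ = B := one_mul _
  calc ‖∫ s in (0 : ℝ)..t, Real.exp (-(t - s) * ‖k‖ ^ 2) • coeff v₀ (m + 2) s k‖
      ≤ B * |t - 0| := intervalIntegral.norm_integral_le_of_norm_le_const hbound
    _ = t * B := by rw [sub_zero, abs_of_nonneg ht, mul_comm]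

/-- Geometric bounds of the coefficients on `[0, τ]` give geometric decay of all the terms of (3)
at time `τ` (with a ratio `< 1` if the given one is): the input of
`LiSinai.energy_lt_top_of_mode_geometric` — "for `p ≫ O(1/Δt)` the product `A_cr Λ(t')^p`
tends exponentially to zero", §10 p. 312. [cite: LiSinai2008, §10 p. 312] -/
theorem exists_modeDecay_of_coeffBound {v₀ : ℝ³ → ℝ³} {a R M₀ : ℝ}
    (hv₀m : Measurable v₀) (hv₀ : ∀ k, v₀ k ≠ 0 → a ≤ k 2 ∧ ‖k‖ ≤ R) (hM₀ : ∀ k, ‖v₀ k‖ ≤ M₀)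
    {τ C ρ : ℝ} (hτ : 0 ≤ τ) (hρ0 : 0 ≤ ρ) (hρ1 : ρ < 1)
    (hb : ∀ p, ∀ s ∈ Icc 0 τ, ∀ k, ‖coeff v₀ p s k‖ ≤ C * ρ ^ p) :
    ∃ C' q : ℝ, 0 ≤ q ∧ q < 1 ∧ ∀ p k, ‖mode v₀ p τ k‖ ≤ C' * q ^ p := by
  set q : ℝ := max ρ (1 / 2) with hq
  have hq0 : 0 ≤ q := hρ0.trans (le_max_left _ _)
  have hq1 : q < 1 := max_lt hρ1 (by norm_num)
  have hqhalf : 1 / 2 ≤ q := le_max_right _ _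
  have hM₀' : 0 ≤ M₀ := (norm_nonneg _).trans (hM₀ 0)
  refine ⟨τ * |C| + 2 * M₀, q, hq0, hq1, fun p k => ?_⟩
  have hCq : 0 ≤ τ * |C| + 2 * M₀ := by positivity
  rcases p with _ | _ | m
  · simp [mode_zero, hCq]
  · show ‖mode v₀ 1 τ k‖ ≤ (τ * |C| + 2 * M₀) * q ^ 1
    rw [mode_one, norm_smul, Real.norm_eq_abs, abs_of_pos (Real.exp_pos _), pow_one]
    have hexp : Real.exp (-τ * ‖k‖ ^ 2) ≤ 1 := by
      rw [Real.exp_le_one_iff]; nlinarith [sq_nonneg ‖k‖]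
    calc Real.exp (-τ * ‖k‖ ^ 2) * ‖v₀ k‖ ≤ 1 * M₀ :=
          mul_le_mul hexp (hM₀ k) (norm_nonneg _) zero_le_one
      _ = 2 * M₀ * (1 / 2) := by ring
      _ ≤ 2 * M₀ * q := mul_le_mul_of_nonneg_left hqhalf (by positivity)
      _ ≤ (τ * |C| + 2 * M₀) * q := by gcongr; linarith [abs_nonneg C, mul_nonneg hτ (abs_nonneg C)]
  · show ‖mode v₀ (m + 2) τ k‖ ≤ (τ * |C| + 2 * M₀) * q ^ (m + 2)
    have h := norm_mode_le_of_coeff_bound hv₀m hv₀ hM₀ hτ m k fun s hs => hb (m + 2) s hs k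
    have hρq : ρ ^ (m + 2) ≤ q ^ (m + 2) := pow_le_pow_left₀ hρ0 (le_max_left _ _) _
    calc ‖mode v₀ (m + 2) τ k‖ ≤ τ * (C * ρ ^ (m + 2)) := h
      _ ≤ τ * (|C| * q ^ (m + 2)) := by
          refine mul_le_mul_of_nonneg_left ?_ hτ
          calc C * ρ ^ (m + 2) ≤ |C| * ρ ^ (m + 2) :=
                mul_le_mul_of_nonneg_right (le_abs_self C) (pow_nonneg hρ0 _)
            _ ≤ |C| * q ^ (m + 2) := mul_le_mul_of_nonneg_left hρq (abs_nonneg C)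
      _ = (τ * |C|) * q ^ (m + 2) := by ring
      _ ≤ (τ * |C| + 2 * M₀) * q ^ (m + 2) := by gcongr; linarith

/-! ### Infinite energy from sign-coherent terms (the mechanism of "O(p) on a domain of size O(√p)") -/

/-- For nonnegative reals the sum of the squares is at most the square of the sum. [folklore] -/
theorem sum_sq_le_sq_sum {ι : Type*} (s : Finset ι) {f : ι → ℝ} (hf : ∀ i ∈ s, 0 ≤ f i) :
    ∑ i ∈ s, f i ^ 2 ≤ (∑ i ∈ s, f i) ^ 2 := by
  rw [sq (∑ i ∈ s, f i), Finset.sum_mul]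
  refine Finset.sum_le_sum fun i hi => ?_
  rw [sq]
  exact mul_le_mul_of_nonneg_left (Finset.single_le_sum hf hi) (hf i hi)

/-- **Infinite energy from sign-coherent terms.** Let `v₀` be measurable and vanish off
`{a ≤ k₃, |k| ≤ R}`, `a > 0`, fix a time `t`, a direction `e` and a measurable set `G` of
wave vectors. Write `x_p(k) = ⟨e, mode v₀ p (t, k)⟩` for the `e`-components of the terms of the
series (3) (a finite sum at each `k`). If on `G` the POSITIVE parts are small in the sense
`Σ_p x_p(k)⁺ ≤ F(k)` with `∫_G F² < ∞`, while the NEGATIVE parts are large in the sense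
`Σ_p ∫_G (x_p(k)⁻)² dk = ∞`, then the energy `∫ |seriesSolution v₀ (t, k)|² dk` is infinite.
Indeed `Σ_p x_p⁻ = Σ_p x_p⁺ - ⟨e, v(t,k)⟩ ≤ F + |e| |v(t,k)|` and, all `x_p⁻` being `≥ 0`,
`Σ_p (x_p⁻)² ≤ (Σ_p x_p⁻)² ≤ 2F² + 2|e|²|v|²`; integrate (Tonelli). This is the honest form of
"it takes values `O(p)` [with the fixed sign structure of `H⁽⁰⁾`] … this immediately implies
that at `t` the energy is infinite" (§10 p. 312): sizes alone give infinite energy only for SOME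
amplitude (`ComplexNavierStokesBlowupSeriesRate.lean`), sign coherence gives it at the GIVEN one,
no cancellation between terms of different order being possible. [cite: LiSinai2008, §10 p. 312] -/
theorem energy_eq_top_of_signedModes {v₀ : ℝ³ → ℝ³} {a R : ℝ} (ha : 0 < a)
    (hv₀m : Measurable v₀) (hv₀ : ∀ k, v₀ k ≠ 0 → a ≤ k 2 ∧ ‖k‖ ≤ R) (t : ℝ) (e : ℝ³)
    {G : Set ℝ³} (hG : MeasurableSet G) {F : ℝ³ → ℝ≥0∞} (hF : ∫⁻ k in G, F k ^ 2 < ∞)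
    (hpos : ∀ k ∈ G, ∑' p, ENNReal.ofReal (max ⟪e, mode v₀ p t k⟫ 0) ≤ F k)
    (hneg : ∑' p, ∫⁻ k in G, ENNReal.ofReal (max (-⟪e, mode v₀ p t k⟫) 0 ^ 2) = ∞) :
    ∫⁻ k, ‖seriesSolution v₀ t k‖ₑ ^ 2 = ∞ := by
  set x : ℕ → ℝ³ → ℝ := fun p k => ⟪e, mode v₀ p t k⟫ with hx
  have hxm : ∀ p, Measurable (x p) := fun p =>
    measurable_const.inner (measurable_mode_slice hv₀m p t)
  -- pointwise inequality on `G`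
  have hpt : ∀ k ∈ G, ∑' p, ENNReal.ofReal (max (-(x p k)) 0 ^ 2) ≤
      2 * F k ^ 2 + 2 * ‖e‖ₑ ^ 2 * ‖seriesSolution v₀ t k‖ₑ ^ 2 := by
    intro k hk
    set N : ℕ := ⌊k 2 / a⌋₊ + 1 with hN
    have hkN : k 2 < (N : ℝ) * a := lt_floor_succ_mul ha (k 2)
    have hvan : ∀ p, p ∉ Finset.range N → x p k = 0 := by
      intro p hp
      have h0 : mode v₀ p t k = 0 := mode_eq_zero_of_le ha hv₀ hkN (by simpa using hp) t
      simp only [hx, h0, inner_zero_right]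
    have htsum_neg : ∑' p, ENNReal.ofReal (max (-(x p k)) 0 ^ 2) =
        ∑ p ∈ Finset.range N, ENNReal.ofReal (max (-(x p k)) 0 ^ 2) := by
      refine tsum_eq_sum fun p hp => ?_
      simp [hvan p hp]
    have hPF : ∑ p ∈ Finset.range N, ENNReal.ofReal (max (x p k) 0) ≤ F k :=
      (ENNReal.sum_le_tsum _).trans (hpos k hk)
    set P : ℝ := ∑ p ∈ Finset.range N, max (x p k) 0 with hP
    set M : ℝ := ∑ p ∈ Finset.range N, max (-(x p k)) 0 with hM
    have hP0 : 0 ≤ P := Finset.sum_nonneg fun p _ => le_max_right _ _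
    have hM0 : 0 ≤ M := Finset.sum_nonneg fun p _ => le_max_right _ _
    have hσ : ∑ p ∈ Finset.range N, x p k = ⟪e, seriesSolution v₀ t k⟫ := by
      rw [seriesSolution_eq_sum ha hv₀ hkN t, inner_sum]
    have hPM : P - M = ⟪e, seriesSolution v₀ t k⟫ := by
      rw [← hσ, hP, hM, ← Finset.sum_sub_distrib]
      exact Finset.sum_congr rfl fun p _ => max_zero_sub_eq_self (x p k)
    have hMle : M ≤ P + ‖e‖ * ‖seriesSolution v₀ t k‖ := by
      have h1 : |⟪e, seriesSolution v₀ t k⟫| ≤ ‖e‖ * ‖seriesSolution v₀ t k‖ :=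
        abs_real_inner_le_norm _ _
      have h2 : -(P - M) ≤ |⟪e, seriesSolution v₀ t k⟫| := by rw [hPM]; exact neg_le_abs _
      linarith
    have hsq : ∑ p ∈ Finset.range N, max (-(x p k)) 0 ^ 2 ≤
        2 * P ^ 2 + 2 * (‖e‖ * ‖seriesSolution v₀ t k‖) ^ 2 := by
      calc ∑ p ∈ Finset.range N, max (-(x p k)) 0 ^ 2 ≤ M ^ 2 :=
            sum_sq_le_sq_sum _ fun p _ => le_max_right _ _
        _ ≤ (P + ‖e‖ * ‖seriesSolution v₀ t k‖) ^ 2 := pow_le_pow_left₀ hM0 hMle 2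
        _ ≤ 2 * P ^ 2 + 2 * (‖e‖ * ‖seriesSolution v₀ t k‖) ^ 2 := by
            nlinarith [sq_nonneg (P - ‖e‖ * ‖seriesSolution v₀ t k‖)]
    have hconv : ENNReal.ofReal (2 * P ^ 2 + 2 * (‖e‖ * ‖seriesSolution v₀ t k‖) ^ 2) =
        2 * ENNReal.ofReal P ^ 2 + 2 * ‖e‖ₑ ^ 2 * ‖seriesSolution v₀ t k‖ₑ ^ 2 := by
      rw [ENNReal.ofReal_add (by positivity) (by positivity), ENNReal.ofReal_mul zero_le_two,
        ENNReal.ofReal_mul zero_le_two, ENNReal.ofReal_ofNat, ENNReal.ofReal_pow hP0,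
        ENNReal.ofReal_pow (mul_nonneg (norm_nonneg e) (norm_nonneg _)),
        ENNReal.ofReal_mul (norm_nonneg e), ofReal_norm, ofReal_norm, mul_pow,
        mul_assoc]
    have hPF' : ENNReal.ofReal P ≤ F k := by
      rw [hP, ENNReal.ofReal_sum_of_nonneg fun p _ => le_max_right _ _]
      exact hPF
    rw [htsum_neg, ← ENNReal.ofReal_sum_of_nonneg fun p _ => by positivity]
    calc ENNReal.ofReal (∑ p ∈ Finset.range N, max (-(x p k)) 0 ^ 2)
        ≤ ENNReal.ofReal (2 * P ^ 2 + 2 * (‖e‖ * ‖seriesSolution v₀ t k‖) ^ 2) :=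
          ENNReal.ofReal_le_ofReal hsq
      _ = 2 * ENNReal.ofReal P ^ 2 + 2 * ‖e‖ₑ ^ 2 * ‖seriesSolution v₀ t k‖ₑ ^ 2 := hconv
      _ ≤ 2 * F k ^ 2 + 2 * ‖e‖ₑ ^ 2 * ‖seriesSolution v₀ t k‖ₑ ^ 2 := by gcongr
  -- integrate over `G`
  have hmeas_neg : ∀ p, Measurable fun k => ENNReal.ofReal (max (-(x p k)) 0 ^ 2) := fun p =>
    (((hxm p).neg.max measurable_const).pow_const 2).ennreal_ofReal
  have hvm : Measurable fun k => ‖seriesSolution v₀ t k‖ₑ ^ 2 :=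
    (measurable_seriesSolution ha hv₀m hv₀ t).enorm.pow_const 2
  have hint : ∑' p, ∫⁻ k in G, ENNReal.ofReal (max (-(x p k)) 0 ^ 2) ≤
      (2 * ∫⁻ k in G, F k ^ 2) + 2 * ‖e‖ₑ ^ 2 * ∫⁻ k in G, ‖seriesSolution v₀ t k‖ₑ ^ 2 := by
    calc ∑' p, ∫⁻ k in G, ENNReal.ofReal (max (-(x p k)) 0 ^ 2)
        = ∫⁻ k in G, ∑' p, ENNReal.ofReal (max (-(x p k)) 0 ^ 2) :=
          (lintegral_tsum fun p => (hmeas_neg p).aemeasurable).symm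
      _ ≤ ∫⁻ k in G, (2 * F k ^ 2 + 2 * ‖e‖ₑ ^ 2 * ‖seriesSolution v₀ t k‖ₑ ^ 2) :=
          setLIntegral_mono' hG hpt
      _ = (∫⁻ k in G, 2 * F k ^ 2) + ∫⁻ k in G, 2 * ‖e‖ₑ ^ 2 * ‖seriesSolution v₀ t k‖ₑ ^ 2 :=
          lintegral_add_right _ (hvm.const_mul _)
      _ = (2 * ∫⁻ k in G, F k ^ 2) + 2 * ‖e‖ₑ ^ 2 * ∫⁻ k in G, ‖seriesSolution v₀ t k‖ₑ ^ 2 := by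
          rw [lintegral_const_mul' _ _ ENNReal.ofNat_ne_top, lintegral_const_mul _ hvm]
  rw [hneg, top_le_iff] at hint
  have hGtop : ∫⁻ k in G, ‖seriesSolution v₀ t k‖ₑ ^ 2 = ∞ := by
    by_contra hne
    have h1 : 2 * ∫⁻ k in G, F k ^ 2 ≠ ∞ := ENNReal.mul_ne_top ENNReal.ofNat_ne_top hF.ne
    have h2 : 2 * ‖e‖ₑ ^ 2 * ∫⁻ k in G, ‖seriesSolution v₀ t k‖ₑ ^ 2 ≠ ∞ :=
      ENNReal.mul_ne_top (ENNReal.mul_ne_top ENNReal.ofNat_ne_top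
        (ENNReal.pow_ne_top enorm_ne_top)) hne
    exact ENNReal.add_ne_top.2 ⟨h1, h2⟩ hint
  exact top_le_iff.1 (hGtop ▸ setLIntegral_le_lintegral G _)

/-- The square of a geometric sum of ball indicators has finite integral:
`∫ (Σ_p 1_{B(0, p|R|)} B q^p)² dk ≤ (Σ_p B q^p) · (Σ_p B q^p vol B(0, p|R|)) < ∞` for
`0 ≤ q < 1`, `B ≥ 0`. [folklore] -/
theorem lintegral_sq_tsum_ballIndicator_lt_top {B q : ℝ} (hB : 0 ≤ B) (hq0 : 0 ≤ q)
    (hq1 : q < 1) (R : ℝ) :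
    ∫⁻ k, (∑' p : ℕ, (Metric.closedBall (0 : ℝ³) ((p : ℝ) * |R|)).indicator
      (fun _ => ENNReal.ofReal (B * q ^ p)) k) ^ 2 < ∞ := by
  have hqn : ‖q‖ < 1 := by rwa [Real.norm_eq_abs, abs_of_nonneg hq0]
  set Φ : ℝ³ → ℝ≥0∞ := fun k => ∑' p : ℕ, (Metric.closedBall (0 : ℝ³) ((p : ℝ) * |R|)).indicator
      (fun _ => ENNReal.ofReal (B * q ^ p)) k with hΦ
  set S : ℝ≥0∞ := ∑' p : ℕ, ENNReal.ofReal (B * q ^ p) with hS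
  have hStop : S < ∞ := by
    rw [hS, ← ENNReal.ofReal_tsum_of_nonneg (fun p => by positivity)
      ((summable_geometric_of_lt_one hq0 hq1).mul_left B)]
    exact ENNReal.ofReal_lt_top
  have hsup : ∀ k, Φ k ≤ S := fun k =>
    ENNReal.tsum_le_tsum fun p => Set.indicator_le_self' (fun _ _ => zero_le) k
  set T : ℝ≥0∞ := ∑' p : ℕ, ENNReal.ofReal (B * q ^ p) *
    volume (Metric.closedBall (0 : ℝ³) ((p : ℝ) * |R|)) with hT
  have hTtop : T < ∞ := by
    have hterm : ∀ p : ℕ, ENNReal.ofReal (B * q ^ p) *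
        volume (Metric.closedBall (0 : ℝ³) ((p : ℝ) * |R|)) =
        ENNReal.ofReal (B * |R| ^ 3 * ballVol 1 * ((p : ℝ) ^ 3 * q ^ p)) := by
      intro p
      have hp : 0 ≤ (p : ℝ) * |R| := by positivity
      rw [volume_closedBall_eq_ofReal_ballVol, ballVol_eq_pow_mul hp,
        ← ENNReal.ofReal_mul (by positivity)]
      congr 1
      ring
    have hsum : Summable fun p : ℕ => B * |R| ^ 3 * ballVol 1 * ((p : ℝ) ^ 3 * q ^ p) :=
      (summable_pow_mul_geometric_of_norm_lt_one 3 hqn).mul_left _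
    rw [hT, tsum_congr hterm, ← ENNReal.ofReal_tsum_of_nonneg (fun p => ?_) hsum]
    · exact ENNReal.ofReal_lt_top
    · have := ballVol_nonneg 1
      positivity
  have hL1 : ∫⁻ k, Φ k ≤ T := by
    refine le_of_eq ?_
    calc ∫⁻ k, Φ k = ∑' p : ℕ, ∫⁻ k, (Metric.closedBall (0 : ℝ³) ((p : ℝ) * |R|)).indicator
          (fun _ => ENNReal.ofReal (B * q ^ p)) k :=
          lintegral_tsum fun p =>
            ((measurable_const.indicator measurableSet_closedBall).aemeasurable)
      _ = T := tsum_congr fun p => lintegral_indicator_const measurableSet_closedBall _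
  calc ∫⁻ k, Φ k ^ 2 = ∫⁻ k, Φ k * Φ k := by simp_rw [sq]
    _ ≤ ∫⁻ k, S * Φ k := lintegral_mono fun k => mul_le_mul_left (hsup k) _
    _ = S * ∫⁻ k, Φ k := lintegral_const_mul' S _ hStop.ne
    _ ≤ S * T := mul_le_mul_right hL1 S
    _ < ∞ := ENNReal.mul_lt_top hStop hTtop


/-! ### §10 of the source: infinite energy AT the critical time from the profile of the coefficients -/

/-- **Infinite energy at the critical time from a Theorem-1-type profile of the coefficients**
(§10 p. 312, first paragraph, made honest for the explicit all-time solution). Let `v₀` be an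
admissible datum (measurable, bounded, vanishing off `{a ≤ k₃, |k| ≤ R}`, `a > 0`) — think of
Li–Sinai's critical datum `A_cr(t) v(k, 0)`, `A_cr(t) = Λ(t)⁻¹`, the amplitude being absorbed
(`mode_smul`, so that `Λ(t) = 1` below) — and let `t ≥ η > 0`, `e` a direction, `G` a
measurable set of wave vectors containing measurable "cores" `Core p` (`p ≥ p*`, `p* ≥ 2`) with
`c₀ p ≤ |k| ≤ c₁ p` on `Core p` and `vol (Core p) ≥ κ p`. Assume, for the coefficients
`g_p = coeff v₀ p` of (5)–(6):
* (early smallness) `‖g_p(k, s)‖ ≤ C ρ^p` for `s ∈ [0, t - η]`, all `p, k`, some `ρ < 1`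
  (= `Λ(s) < Λ(t)` away from `t`, the second paragraph of §10);
* (sign) `⟨e, g_p(k, s)⟩ ≤ 0` for `p ≥ p*`, `s ∈ [t - η, t]`, `k ∈ G` (the fixed sign of the
  leading Hermite coefficient, `H⁽⁰⁾₁ = -2Y₁` on `{Y₁ > 0}`, Case 2 p. 276 and §7 p. 295, once
  `sup |δ⁽ᵖ⁾| → 0`, inside the domain of Thm. 1 (a₁) p. 311);
* (size) `⟨e, g_p(k, s)⟩ ≤ -c p` for `p ≥ p*`, `k ∈ Core p` and `s` in the final window
  `[t - 1/|k|², t] ∩ [t - η, t]` ("it takes values `O(p)`" on a domain of size `O(√p)` around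
  `K⁽ᵖ⁾`, §10 p. 312 from `g̃_p = p Z(s) Λ(s)^p e^{-|Y|²/2}(H⁽⁰⁾ + δ⁽ᵖ⁾)`, Thm. 1 (a₁)).
Then `∫ |seriesSolution v₀ (t, k)|² dk = ∞`. Proof: by `inner_mode_le_of_sign` the
`e`-components of the terms of (3) have positive parts `≤ t|e|C ρ^p 1_{|k| ≤ p|R|}` on
`G ∩ {|k| > p*|R|}` (square integrable in total, `lintegral_sq_tsum_ballIndicator_lt_top`), by
`inner_mode_le_of_lower` (heat factor `≥ e⁻¹` on the final window, `|k|² ≤ c₁² p²`) their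
negative parts are `≥ d/p` on `Core p` for large `p`, `d = e⁻¹c/(2c₁²)`, whence
`Σ_p ∫ (x_p⁻)² ≥ Σ_p (d/p)² κ p = ∞`; conclude by `energy_eq_top_of_signedModes`. The three
displayed hypotheses are what Theorem 1 p. 311 is used for in §10; they are NOT proved here
(Theorem 1 is a renormalisation-group theorem with computer-assisted steps, §7 p. 295, p. 302),
and the early-smallness hypothesis concerns the `t`-critical datum at times `s < t`, which
Theorem 1 (parameters `b(s)` depending on `s`) does not literally state — see the audit in
`ComplexNavierStokesBlowupProofs.lean`. [cite: LiSinai2008, Thm. 1 p. 311 and §10 p. 312] -/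
theorem energy_eq_top_of_coeffProfile {v₀ : ℝ³ → ℝ³} {a R M₀ : ℝ} (ha : 0 < a)
    (hv₀m : Measurable v₀) (hv₀ : ∀ k, v₀ k ≠ 0 → a ≤ k 2 ∧ ‖k‖ ≤ R) (hM₀ : ∀ k, ‖v₀ k‖ ≤ M₀)
    {t η : ℝ} (hη : 0 < η) (hηt : η ≤ t) (e : ℝ³)
    {G : Set ℝ³} (hG : MeasurableSet G) {Core : ℕ → Set ℝ³} (hCm : ∀ p, MeasurableSet (Core p))
    {pstar : ℕ} {c c₀ c₁ κ C ρ : ℝ} (hp2 : 2 ≤ pstar) (hc : 0 < c) (hc₀ : 0 < c₀) (hc₁ : 0 < c₁)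
    (hκ : 0 < κ) (hρ0 : 0 ≤ ρ) (hρ1 : ρ < 1)
    (hCoreG : ∀ p, pstar ≤ p → Core p ⊆ G)
    (hCoreNorm : ∀ p, pstar ≤ p → ∀ k ∈ Core p, c₀ * p ≤ ‖k‖ ∧ ‖k‖ ≤ c₁ * p)
    (hCoreVol : ∀ p, pstar ≤ p → ENNReal.ofReal (κ * p) ≤ volume (Core p))
    (hEarly : ∀ p, ∀ s ∈ Icc 0 (t - η), ∀ k, ‖coeff v₀ p s k‖ ≤ C * ρ ^ p)
    (hSign : ∀ p, pstar ≤ p → ∀ s ∈ Icc (t - η) t, ∀ k ∈ G, ⟪e, coeff v₀ p s k⟫ ≤ 0)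
    (hLower : ∀ p, pstar ≤ p → ∀ k ∈ Core p, ∀ s ∈ Icc (t - η) t, t - (‖k‖ ^ 2)⁻¹ ≤ s →
      ⟪e, coeff v₀ p s k⟫ ≤ -(c * p)) :
    ∫⁻ k, ‖seriesSolution v₀ t k‖ₑ ^ 2 = ∞ := by
  have ht0 : 0 < t := hη.trans_le hηt
  have htη : 0 ≤ t - η := sub_nonneg.2 hηt
  have hC : 0 ≤ C := by simpa [coeff_zero] using hEarly 0 0 ⟨le_rfl, htη⟩ 0
  -- the constants
  set Bc : ℝ := t * ‖e‖ * C with hBc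
  have hBc0 : 0 ≤ Bc := by positivity
  set d : ℝ := Real.exp (-1) * c / (2 * c₁ ^ 2) with hd
  have hd0 : 0 < d := by positivity
  -- the region fed to `energy_eq_top_of_signedModes`: `G` minus the supports of the low modes
  set G' : Set ℝ³ := G ∩ {k | (pstar : ℝ) * |R| < ‖k‖} with hG'
  have hG'm : MeasurableSet G' := hG.inter (measurableSet_lt measurable_const measurable_norm)
  -- Step 1: upper bound of the `e`-components on `G`, `p ≥ p*`
  have hstep1 : ∀ p, pstar ≤ p → ∀ k ∈ G, ⟪e, mode v₀ p t k⟫ ≤ Bc * ρ ^ p := by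
    intro p hp k hk
    obtain ⟨m, rfl⟩ : ∃ m, p = m + 2 := ⟨p - 2, by omega⟩
    have h := inner_mode_le_of_sign hv₀m hv₀ hM₀ htη (by linarith) m k e
      (fun s hs => hEarly (m + 2) s hs k) (fun s hs => hSign (m + 2) hp s hs k hk)
    calc ⟪e, mode v₀ (m + 2) t k⟫ ≤ (t - η) * (‖e‖ * (C * ρ ^ (m + 2))) := h
      _ ≤ t * (‖e‖ * (C * ρ ^ (m + 2))) :=
          mul_le_mul_of_nonneg_right (by linarith) (by positivity)
      _ = Bc * ρ ^ (m + 2) := by rw [hBc]; ring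
  -- Step 2: positive parts on `G'` are dominated by a geometric sum of ball indicators
  have hpospt : ∀ k ∈ G', ∀ p, ENNReal.ofReal (max ⟪e, mode v₀ p t k⟫ 0) ≤
      (Metric.closedBall (0 : ℝ³) ((p : ℝ) * |R|)).indicator
        (fun _ => ENNReal.ofReal (Bc * ρ ^ p)) k := by
    intro k hk p
    by_cases hk0 : mode v₀ p t k = 0
    · simp [hk0]
    have hkR : ‖k‖ ≤ (p : ℝ) * |R| := (mode_support hv₀ p t k hk0).2.trans
      (mul_le_mul_of_nonneg_left (le_abs_self R) (by positivity))
    rw [Set.indicator_of_mem (mem_closedBall_zero_iff.2 hkR)]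
    have hp : pstar ≤ p := by
      by_contra hlt
      have h1 : (p : ℝ) * |R| ≤ (pstar : ℝ) * |R| :=
        mul_le_mul_of_nonneg_right (by exact_mod_cast (not_le.1 hlt).le) (abs_nonneg R)
      exact absurd (hkR.trans h1) (not_le.2 hk.2)
    exact ENNReal.ofReal_le_ofReal (max_le (hstep1 p hp k hk.1) (by positivity))
  set F : ℝ³ → ℝ≥0∞ := fun k => ∑' p : ℕ, (Metric.closedBall (0 : ℝ³) ((p : ℝ) * |R|)).indicator
      (fun _ => ENNReal.ofReal (Bc * ρ ^ p)) k with hF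
  have hFint : ∫⁻ k in G', F k ^ 2 < ∞ :=
    lt_of_le_of_lt (setLIntegral_le_lintegral G' _)
      (lintegral_sq_tsum_ballIndicator_lt_top hBc0 hρ0 hρ1 R)
  have hpos : ∀ k ∈ G', ∑' p, ENNReal.ofReal (max ⟪e, mode v₀ p t k⟫ 0) ≤ F k := fun k hk =>
    ENNReal.tsum_le_tsum fun p => hpospt k hk p
  -- Step 3: thresholds in `p`
  have hE1 : ∀ᶠ p : ℕ in atTop, pstar ≤ p := eventually_ge_atTop pstar
  have hlin : Tendsto (fun p : ℕ => c₀ * (p : ℝ)) atTop atTop :=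
    tendsto_natCast_atTop_atTop.const_mul_atTop hc₀
  have hE2 : ∀ᶠ p : ℕ in atTop, (pstar : ℝ) * |R| < c₀ * p := hlin.eventually_gt_atTop _
  have hE3 : ∀ᶠ p : ℕ in atTop, η⁻¹ ≤ (c₀ * p) ^ 2 :=
    ((tendsto_pow_atTop two_ne_zero).comp hlin).eventually_ge_atTop _
  have hE4 : ∀ᶠ p : ℕ in atTop, Bc * ((p : ℝ) * ρ ^ p) < d := by
    have h := (tendsto_self_mul_const_pow_of_lt_one hρ0 hρ1).const_mul Bc
    rw [mul_zero] at h
    exact (tendsto_order.1 h).2 d hd0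
  have hE5 : ∀ᶠ p : ℕ in atTop, 1 ≤ p := eventually_ge_atTop 1
  obtain ⟨p₁, hp₁⟩ := eventually_atTop.1 (hE1.and (hE2.and (hE3.and (hE4.and hE5))))
  -- Step 4: the cores lie in `G'` and the negative parts are `≥ d/p` on them, `p ≥ p₁`
  have hcoreG' : ∀ p, p₁ ≤ p → Core p ⊆ G' := by
    intro p hp k hk
    obtain ⟨hps, hR, -, -, -⟩ := hp₁ p hp
    exact ⟨hCoreG p hps hk, hR.trans_le (hCoreNorm p hps k hk).1⟩
  have hcore : ∀ p, p₁ ≤ p → ∀ k ∈ Core p, d / p ≤ max (-⟪e, mode v₀ p t k⟫) 0 := by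
    intro p hp k hk
    obtain ⟨hps, -, hη', hBd, h1p⟩ := hp₁ p hp
    obtain ⟨hk0, hk1⟩ := hCoreNorm p hps k hk
    have hp0 : (0 : ℝ) < p := by exact_mod_cast h1p
    have hkpos : 0 < ‖k‖ := lt_of_lt_of_le (by positivity) hk0
    have hw : 0 < ‖k‖ ^ 2 := by positivity
    set δ : ℝ := (‖k‖ ^ 2)⁻¹ with hδ
    have hδ0 : 0 < δ := inv_pos.2 hw
    have hδk : δ * ‖k‖ ^ 2 ≤ 1 := by rw [hδ, inv_mul_cancel₀ hw.ne']
    have hδη : δ ≤ η := by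
      have h1 : (c₀ * p) ^ 2 ≤ ‖k‖ ^ 2 := pow_le_pow_left₀ (by positivity) hk0 2
      rw [hδ]
      exact inv_le_of_inv_le₀ hη (hη'.trans h1)
    have hδ1 : ((c₁ * p) ^ 2)⁻¹ ≤ δ := by
      rw [hδ]
      exact inv_anti₀ hw (pow_le_pow_left₀ (norm_nonneg _) hk1 2)
    obtain ⟨m, rfl⟩ : ∃ m, p = m + 2 := ⟨p - 2, by omega⟩
    have hx := inner_mode_le_of_lower hv₀m hv₀ hM₀ htη hδ0 (by linarith) m k e
      (fun s hs => hEarly (m + 2) s hs k)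
      (fun s hs => hSign (m + 2) hps s hs k (hCoreG _ hps hk))
      (by positivity : (0 : ℝ) ≤ c * ((m + 2 : ℕ) : ℝ))
      (fun s hs => hLower (m + 2) hps k hk s ⟨by linarith [hs.1], hs.2⟩ hs.1) hδk
    have hA : (t - η) * (‖e‖ * (C * ρ ^ (m + 2))) ≤ Bc * ρ ^ (m + 2) := by
      calc (t - η) * (‖e‖ * (C * ρ ^ (m + 2))) ≤ t * (‖e‖ * (C * ρ ^ (m + 2))) :=
            mul_le_mul_of_nonneg_right (by linarith) (by positivity)
        _ = Bc * ρ ^ (m + 2) := by rw [hBc]; ring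
    have hB' : Bc * ρ ^ (m + 2) ≤ d / ((m + 2 : ℕ) : ℝ) := by
      rw [le_div_iff₀ hp0]
      calc Bc * ρ ^ (m + 2) * ((m + 2 : ℕ) : ℝ) = Bc * (((m + 2 : ℕ) : ℝ) * ρ ^ (m + 2)) := by
            ring
        _ ≤ d := hBd.le
    have hL : 2 * d / ((m + 2 : ℕ) : ℝ) ≤ δ * (Real.exp (-1) * (c * ((m + 2 : ℕ) : ℝ))) := by
      calc 2 * d / ((m + 2 : ℕ) : ℝ)
          = ((c₁ * ((m + 2 : ℕ) : ℝ)) ^ 2)⁻¹ * (Real.exp (-1) * (c * ((m + 2 : ℕ) : ℝ))) := by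
            rw [hd]
            field_simp
        _ ≤ δ * (Real.exp (-1) * (c * ((m + 2 : ℕ) : ℝ))) :=
            mul_le_mul_of_nonneg_right hδ1 (by positivity)
    have hsplit : d / ((m + 2 : ℕ) : ℝ) - 2 * d / ((m + 2 : ℕ) : ℝ) = -(d / ((m + 2 : ℕ) : ℝ)) := by
      ring
    exact le_max_of_le_left (by linarith)
  -- Step 5: divergence of `Σ_p ∫ (x_p⁻)²` over `G'` and conclusion
  have hterm : ∀ p, p₁ ≤ p → ENNReal.ofReal (d ^ 2 * κ / p) ≤
      ∫⁻ k in G', ENNReal.ofReal (max (-⟪e, mode v₀ p t k⟫) 0 ^ 2) := by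
    intro p hp
    obtain ⟨hps, -, -, -, h1p⟩ := hp₁ p hp
    have hp0 : (0 : ℝ) < p := by exact_mod_cast h1p
    have hp0' : (p : ℝ) ≠ 0 := hp0.ne'
    calc ENNReal.ofReal (d ^ 2 * κ / p)
        = ENNReal.ofReal ((d / p) ^ 2) * ENNReal.ofReal (κ * p) := by
          rw [← ENNReal.ofReal_mul (sq_nonneg _)]
          congr 1
          field_simp
      _ ≤ ENNReal.ofReal ((d / p) ^ 2) * volume (Core p) := mul_le_mul_right (hCoreVol p hps) _
      _ = ∫⁻ _ in Core p, ENNReal.ofReal ((d / p) ^ 2) := (setLIntegral_const _ _).symm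
      _ ≤ ∫⁻ k in Core p, ENNReal.ofReal (max (-⟪e, mode v₀ p t k⟫) 0 ^ 2) :=
          setLIntegral_mono' (hCm p) fun k hk =>
            ENNReal.ofReal_le_ofReal (pow_le_pow_left₀ (by positivity) (hcore p hp k hk) 2)
      _ ≤ ∫⁻ k in G', ENNReal.ofReal (max (-⟪e, mode v₀ p t k⟫) 0 ^ 2) :=
          lintegral_mono_set (hcoreG' p hp)
  have hharm : ∑' i : ℕ, ENNReal.ofReal (d ^ 2 * κ / ((i + p₁ : ℕ) : ℝ)) = ∞ := by
    by_contra hne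
    have hne' : ∑' i : ℕ,
        ((Real.toNNReal (d ^ 2 * κ / ((i + p₁ : ℕ) : ℝ)) : NNReal) : ℝ≥0∞) ≠ ∞ := hne
    have hs : Summable fun i : ℕ => d ^ 2 * κ / ((i + p₁ : ℕ) : ℝ) :=
      (NNReal.summable_coe.2 (ENNReal.tsum_coe_ne_top_iff_summable.1 hne')).congr
        fun i => Real.coe_toNNReal _ (by positivity)
    have hdk : d ^ 2 * κ ≠ 0 := by positivity
    have hs' : Summable fun i : ℕ => ((i + p₁ : ℕ) : ℝ)⁻¹ := by
      refine (hs.div_const (d ^ 2 * κ)).congr fun i => ?_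
      rw [div_right_comm, div_self hdk, one_div]
    exact Real.not_summable_natCast_inv
      ((summable_nat_add_iff (f := fun n : ℕ => ((n : ℕ) : ℝ)⁻¹) p₁).1 hs')
  have hneg : ∑' p, ∫⁻ k in G', ENNReal.ofReal (max (-⟪e, mode v₀ p t k⟫) 0 ^ 2) = ∞ := by
    rw [← Summable.sum_add_tsum_nat_add' (M := ℝ≥0∞)
      (f := fun p => ∫⁻ k in G', ENNReal.ofReal (max (-⟪e, mode v₀ p t k⟫) 0 ^ 2)) (k := p₁)
      ENNReal.summable]
    refine top_le_iff.1 (le_add_left ?_)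
    rw [← hharm]
    exact ENNReal.tsum_le_tsum fun i => hterm (i + p₁) (Nat.le_add_left _ _)
  exact energy_eq_top_of_signedModes ha hv₀m hv₀ t e hG'm hFint hpos hneg


/-! ### The windows of Theorem 1 (a₁): cores of linear size and volume -/

/-- Lower corner of Li–Sinai's window of order `p`: in the rescaled variable
`Y = (k - K⁽ᵖ⁾)/√(p k⁽⁰⁾)`, `K⁽ᵖ⁾ = (0, 0, p k⁽⁰⁾)` (p. 270), the box `Y₁ ∈ [1, 2]`, `|Y₂| ≤ 1`,
`|Y₃| ≤ 1`. [cite: LiSinai2008, §2 p. 270 and Thm. 1 (a₁) p. 311] -/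
def coreLo (k₀ : ℝ) (p : ℕ) : Fin 3 → ℝ :=
  ![Real.sqrt (p * k₀), -Real.sqrt (p * k₀), p * k₀ - Real.sqrt (p * k₀)]

/-- Upper corner of Li–Sinai's window of order `p` (see `coreLo`). [cite: LiSinai2008, §2 p. 270
and Thm. 1 (a₁) p. 311] -/
def coreHi (k₀ : ℝ) (p : ℕ) : Fin 3 → ℝ :=
  ![2 * Real.sqrt (p * k₀), Real.sqrt (p * k₀), p * k₀ + Real.sqrt (p * k₀)]

/-- **Li–Sinai's window of order `p`**: the box `K⁽ᵖ⁾ + √(p k⁽⁰⁾) ([1,2] × [-1,1] × [-1,1])` of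
wave vectors, i.e. `|Y| = O(1)` with `Y₁ ∈ [1, 2]` in the variables of Theorem 1 (a₁), where the
leading profile `H⁽⁰⁾₁(Y₁, Y₂) e^{-|Y|²/2} = -2Y₁ e^{-|Y|²/2}` (Case 2 p. 276, `h⁽¹⁾₁₀ = -2`;
§7 p. 295, "`H₁(Y₁, Y₂) = -2Y₁`" for the fixed point with `x₁ = x₂ = x₃ = 0`) is `≤ -2e⁻³`:
"the domain with center `K⁽ᵖ⁾` of size `O(√p)` where `A^p g_p` takes values `O(p)`" of §10.
These are cores as required by `energy_eq_top_of_coeffProfile` (`measurableSet_lsCore`,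
`norm_bounds_of_mem_lsCore`, `le_volume_lsCore`). [cite: LiSinai2008, §4 p. 276, §7 p. 295,
Thm. 1 (a₁) p. 311, §10 p. 312] -/
def lsCore (k₀ : ℝ) (p : ℕ) : Set ℝ³ :=
  (WithLp.ofLp : ℝ³ → (Fin 3 → ℝ)) ⁻¹' Set.Icc (coreLo k₀ p) (coreHi k₀ p)

/-- The windows are measurable (closed boxes). [folklore] -/
theorem measurableSet_lsCore (k₀ : ℝ) (p : ℕ) : MeasurableSet (lsCore k₀ p) :=
  measurableSet_Icc.preimage (WithLp.measurable_ofLp 2 (Fin 3 → ℝ))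

/-- Coordinates of a point of the window of order `p` (`x = p k₀`):
`√x ≤ k₁ ≤ 2√x`, `|k₂| ≤ √x`, `|k₃ - x| ≤ √x`. [folklore] -/
theorem mem_lsCore_iff (k₀ : ℝ) (p : ℕ) (k : ℝ³) :
    k ∈ lsCore k₀ p ↔
      (Real.sqrt (p * k₀) ≤ k 0 ∧ k 0 ≤ 2 * Real.sqrt (p * k₀)) ∧
      (-Real.sqrt (p * k₀) ≤ k 1 ∧ k 1 ≤ Real.sqrt (p * k₀)) ∧
      (p * k₀ - Real.sqrt (p * k₀) ≤ k 2 ∧ k 2 ≤ p * k₀ + Real.sqrt (p * k₀)) := by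
  simp only [lsCore, Set.mem_preimage, Set.mem_Icc, Pi.le_def]
  constructor
  · rintro ⟨hlo, hhi⟩
    have a0 := hlo 0
    have a1 := hlo 1
    have a2 := hlo 2
    have b0 := hhi 0
    have b1 := hhi 1
    have b2 := hhi 2
    simp only [coreLo, coreHi, Matrix.cons_val_zero, Matrix.cons_val_one, Matrix.cons_val_two,
      Matrix.head_cons, Matrix.tail_cons] at a0 a1 a2 b0 b1 b2
    exact ⟨⟨a0, b0⟩, ⟨a1, b1⟩, ⟨a2, b2⟩⟩
  · rintro ⟨⟨a0, b0⟩, ⟨a1, b1⟩, ⟨a2, b2⟩⟩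
    refine ⟨fun i => ?_, fun i => ?_⟩
    · fin_cases i
      · simpa [coreLo] using a0
      · simpa [coreLo] using a1
      · simpa [coreLo, Matrix.cons_val_two, Matrix.head_cons, Matrix.tail_cons] using a2
    · fin_cases i
      · simpa [coreHi] using b0
      · simpa [coreHi] using b1
      · simpa [coreHi, Matrix.cons_val_two, Matrix.head_cons, Matrix.tail_cons] using b2

/-- **Volume of the window**: `vol (lsCore k₀ p) = 4 x √x`, `x = p k₀ ≥ 0` (a box with sides
`√x, 2√x, 2√x`; Lebesgue measure of `ℝ³` is the product measure in coordinates). [folklore] -/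
theorem volume_lsCore {k₀ : ℝ} {p : ℕ} (hx : 0 ≤ (p : ℝ) * k₀) :
    volume (lsCore k₀ p) =
      ENNReal.ofReal (4 * ((p : ℝ) * k₀) * Real.sqrt ((p : ℝ) * k₀)) := by
  rw [lsCore, (PiLp.volume_preserving_ofLp (Fin 3)).measure_preimage
    measurableSet_Icc.nullMeasurableSet, Real.volume_Icc_pi, Fin.prod_univ_three]
  simp only [coreLo, coreHi, Matrix.cons_val_zero, Matrix.cons_val_one, Matrix.cons_val_two,
    Matrix.head_cons, Matrix.tail_cons]
  set r : ℝ := Real.sqrt ((p : ℝ) * k₀) with hr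
  have hr0 : 0 ≤ r := Real.sqrt_nonneg _
  have h1 : 2 * r - r = r := by ring
  have h2 : r - -r = 2 * r := by ring
  have h3 : (p : ℝ) * k₀ + r - ((p : ℝ) * k₀ - r) = 2 * r := by ring
  rw [h1, h2, h3, ← ENNReal.ofReal_mul hr0, ← ENNReal.ofReal_mul (by positivity)]
  congr 1
  have hrr : r * r = (p : ℝ) * k₀ := by rw [hr]; exact Real.mul_self_sqrt hx
  calc r * (2 * r) * (2 * r) = 4 * (r * r) * r := by ring
    _ = 4 * ((p : ℝ) * k₀) * r := by rw [hrr]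

/-- **The windows have volume of linear size**: `vol (lsCore k₀ p) ≥ (4 k₀ √k₀) p` for `p ≥ 1`,
`k₀ ≥ 0` — hypothesis `hCoreVol` of `energy_eq_top_of_coeffProfile` with `κ = 4 k₀ √k₀`.
[folklore] -/
theorem le_volume_lsCore {k₀ : ℝ} (hk₀ : 0 ≤ k₀) {p : ℕ} (hp : 1 ≤ p) :
    ENNReal.ofReal (4 * k₀ * Real.sqrt k₀ * p) ≤ volume (lsCore k₀ p) := by
  have hp1 : (1 : ℝ) ≤ p := by exact_mod_cast hp
  have hx : 0 ≤ (p : ℝ) * k₀ := by positivity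
  rw [volume_lsCore hx]
  refine ENNReal.ofReal_le_ofReal ?_
  have hsq : Real.sqrt k₀ ≤ Real.sqrt ((p : ℝ) * k₀) :=
    Real.sqrt_le_sqrt (by nlinarith)
  calc 4 * k₀ * Real.sqrt k₀ * p = 4 * ((p : ℝ) * k₀) * Real.sqrt k₀ := by ring
    _ ≤ 4 * ((p : ℝ) * k₀) * Real.sqrt ((p : ℝ) * k₀) :=
        mul_le_mul_of_nonneg_left hsq (by positivity)

/-- **The windows have linear size**: for `k ∈ lsCore k₀ p` with `k₀ > 0`, `p ≥ 1` and
`p k₀ ≥ 4` (so that `√(p k₀) ≤ p k₀ / 2`), `(k₀/2) p ≤ |k| ≤ (k₀ + 4√k₀) p` — hypothesis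
`hCoreNorm` of `energy_eq_top_of_coeffProfile`. [folklore] -/
theorem norm_bounds_of_mem_lsCore {k₀ : ℝ} (hk₀ : 0 < k₀) {p : ℕ} (hp : 1 ≤ p)
    (hp4 : 4 ≤ (p : ℝ) * k₀) {k : ℝ³} (hk : k ∈ lsCore k₀ p) :
    k₀ / 2 * p ≤ ‖k‖ ∧ ‖k‖ ≤ (k₀ + 4 * Real.sqrt k₀) * p := by
  have hp1 : (1 : ℝ) ≤ p := by exact_mod_cast hp
  set x : ℝ := (p : ℝ) * k₀ with hx
  have hx0 : 0 ≤ x := by positivity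
  obtain ⟨⟨h0, h0'⟩, ⟨h1, h1'⟩, ⟨h2, h2'⟩⟩ := (mem_lsCore_iff k₀ p k).1 hk
  set r : ℝ := Real.sqrt x with hr
  have hr0 : 0 ≤ r := Real.sqrt_nonneg _
  have hrr : r * r = x := Real.mul_self_sqrt hx0
  -- `√x ≤ x / 2` because `x ≥ 4`
  have hrx : r ≤ x / 2 := by
    rw [hr, Real.sqrt_le_left (by positivity)]
    nlinarith
  -- `√(p k₀) ≤ p √k₀` because `p ≥ 1`
  have hrp : r ≤ (p : ℝ) * Real.sqrt k₀ := by
    rw [hr, Real.sqrt_le_left (by positivity), mul_pow, Real.sq_sqrt hk₀.le, hx]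
    nlinarith
  constructor
  · -- lower bound through the third coordinate
    have h3 : k₀ / 2 * p ≤ k 2 := by
      have : x - r ≤ k 2 := h2
      have hx2 : k₀ / 2 * p = x - x / 2 := by rw [hx]; ring
      linarith
    calc k₀ / 2 * p ≤ k 2 := h3
      _ ≤ |k 2| := le_abs_self _
      _ = ‖k 2‖ := (Real.norm_eq_abs _).symm
      _ ≤ ‖k‖ := PiLp.norm_apply_le k 2
  · -- upper bound through the sum of the coordinates
    have hsum : ‖k‖ ≤ |k 0| + |k 1| + |k 2| := by
      rw [EuclideanSpace.norm_eq, Fin.sum_univ_three, Real.norm_eq_abs, Real.norm_eq_abs,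
        Real.norm_eq_abs, Real.sqrt_le_left (by positivity)]
      nlinarith [abs_nonneg (k 0), abs_nonneg (k 1), abs_nonneg (k 2), sq_abs (k 0),
        sq_abs (k 1), sq_abs (k 2)]
    have ha0 : |k 0| ≤ 2 * r := abs_le.2 ⟨by linarith, h0'⟩
    have ha1 : |k 1| ≤ r := abs_le.2 ⟨h1, h1'⟩
    have ha2 : |k 2| ≤ x + r := abs_le.2 ⟨by linarith, h2'⟩
    calc ‖k‖ ≤ |k 0| + |k 1| + |k 2| := hsum
      _ ≤ 2 * r + r + (x + r) := by linarith
      _ = x + 4 * r := by ring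
      _ ≤ x + 4 * ((p : ℝ) * Real.sqrt k₀) := by linarith
      _ = (k₀ + 4 * Real.sqrt k₀) * p := by rw [hx]; ring

/-- **On the windows, the first rescaled coordinate is bounded below at every order present.**
If `k ∈ lsCore k₀ q` (`q ≥ 1`, `q k₀ ≥ 4`) then `k₁² ≥ q k₀`; if moreover a term of order `p`
of a datum vanishing off `{a ≤ k₃}` is nonzero at `k`, i.e. `p a ≤ k₃` (`mode_support`), then
`p a ≤ (3/2) q k₀`. Hence `Y₁² = k₁²/(p k₀) ≥ 2a/(3k₀)` for every order `p` present at `k`. This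
is why hypothesis (S) of `ComplexNavierStokesBlowup.of_liSinaiWindows` (the sign of `⟨e₁, g_p⟩`
on the union of the windows near `t`) follows from Theorem 1 (a₁) as soon as
`sup_Y |δ₁⁽ᵖ⁾(Y, s)| ≤ 2√(2a/(3k₀))` for `p ≥ p*` (`H⁽⁰⁾₁ = -2Y₁`, §7 p. 295).
[cite: LiSinai2008, Thm. 1 (a₁) p. 311] -/
theorem sq_apply_zero_ge_of_mem_lsCore {k₀ a : ℝ} (hk₀ : 0 < k₀) {q : ℕ} (hq : 1 ≤ q)
    (hq4 : 4 ≤ (q : ℝ) * k₀) {k : ℝ³} (hk : k ∈ lsCore k₀ q) {p : ℕ}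
    (hpk : (p : ℝ) * a ≤ k 2) :
    (q : ℝ) * k₀ ≤ k 0 ^ 2 ∧ (p : ℝ) * a ≤ 3 / 2 * ((q : ℝ) * k₀) := by
  have hq1 : (1 : ℝ) ≤ q := by exact_mod_cast hq
  set x : ℝ := (q : ℝ) * k₀ with hx
  have hx0 : 0 ≤ x := by positivity
  obtain ⟨⟨h0, -⟩, -, ⟨-, h2'⟩⟩ := (mem_lsCore_iff k₀ q k).1 hk
  have hr0 : 0 ≤ Real.sqrt x := Real.sqrt_nonneg _
  have hrx : Real.sqrt x ≤ x / 2 := by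
    rw [Real.sqrt_le_left (by positivity)]
    nlinarith
  refine ⟨?_, ?_⟩
  · calc x = Real.sqrt x ^ 2 := (Real.sq_sqrt hx0).symm
      _ ≤ k 0 ^ 2 := pow_le_pow_left₀ hr0 h0 2
  · linarith

end LiSinai

open LiSinai in
/-- **§10 of Li–Sinai as a sufficient condition for the energy-profile fact.** If ONE admissible
incompressible datum has coefficients `g_p = LiSinai.coeff v₀ p` with
(i) geometric bounds of ratio `< 1` on `[0, τ]` for every `τ < t` ("`Λ(t') < Λ(t)`", which by
`exists_modeDecay_of_coeffBound` and `energy_lt_top_of_mode_geometric` gives finite energy at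
every `τ < t` — the second paragraph of §10), and (ii) near `t` the sign and size structure of
Theorem 1 (a₁) in one direction `e` on cores of linear size and volume (hypotheses of
`LiSinai.energy_eq_top_of_coeffProfile` — the first paragraph of §10), then
`LiSinaiSeriesEnergyBlowup` holds (datum `v₀`, time `t`), hence the catalogued barrier
`ComplexNavierStokesBlowup` (`ComplexNavierStokesBlowup.of_coeffProfile`). So, for the barrier,
the whole Theorem-1 input of the source is the conjunction (i) ∧ (ii) about the explicit
recursion (5)–(6) for one datum; neither is proved here. [cite: LiSinai2008, Thm. 1 p. 311 and
§10 p. 312] -/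
theorem LiSinaiSeriesEnergyBlowup.of_coeffProfile
    {v₀ : EuclideanSpace ℝ (Fin 3) → EuclideanSpace ℝ (Fin 3)} {a R M₀ : ℝ} (ha : 0 < a)
    (hv₀m : Measurable v₀) (hv₀ : ∀ k, v₀ k ≠ 0 → a ≤ k 2 ∧ ‖k‖ ≤ R) (hM₀ : ∀ k, ‖v₀ k‖ ≤ M₀)
    (hdiv : ∀ k, ⟪v₀ k, k⟫ = 0)
    {t η : ℝ} (hη : 0 < η) (hηt : η ≤ t) (e : EuclideanSpace ℝ (Fin 3))
    {G : Set (EuclideanSpace ℝ (Fin 3))} (hG : MeasurableSet G)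
    {Core : ℕ → Set (EuclideanSpace ℝ (Fin 3))} (hCm : ∀ p, MeasurableSet (Core p))
    {pstar : ℕ} {c c₀ c₁ κ : ℝ} (hp2 : 2 ≤ pstar) (hc : 0 < c) (hc₀ : 0 < c₀) (hc₁ : 0 < c₁)
    (hκ : 0 < κ)
    (hCoreG : ∀ p, pstar ≤ p → Core p ⊆ G)
    (hCoreNorm : ∀ p, pstar ≤ p → ∀ k ∈ Core p, c₀ * p ≤ ‖k‖ ∧ ‖k‖ ≤ c₁ * p)
    (hCoreVol : ∀ p, pstar ≤ p → ENNReal.ofReal (κ * p) ≤ volume (Core p))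
    (hU : ∀ τ ∈ Ico 0 t, ∃ C ρ : ℝ, 0 ≤ ρ ∧ ρ < 1 ∧
      ∀ p, ∀ s ∈ Icc 0 τ, ∀ k, ‖coeff v₀ p s k‖ ≤ C * ρ ^ p)
    (hSign : ∀ p, pstar ≤ p → ∀ s ∈ Icc (t - η) t, ∀ k ∈ G, ⟪e, coeff v₀ p s k⟫ ≤ 0)
    (hLower : ∀ p, pstar ≤ p → ∀ k ∈ Core p, ∀ s ∈ Icc (t - η) t, t - (‖k‖ ^ 2)⁻¹ ≤ s →
      ⟪e, coeff v₀ p s k⟫ ≤ -(c * p)) :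
    LiSinaiSeriesEnergyBlowup := by
  have ht : 0 < t := hη.trans_le hηt
  obtain ⟨C, ρ, hρ0, hρ1, hEarly⟩ := hU (t - η) ⟨sub_nonneg.2 hηt, by linarith⟩
  have hinf := energy_eq_top_of_coeffProfile ha hv₀m hv₀ hM₀ hη hηt e hG hCm hp2 hc hc₀ hc₁ hκ
    hρ0 hρ1 hCoreG hCoreNorm hCoreVol hEarly hSign hLower
  refine LiSinaiSeriesEnergyBlowup.of_infinite_of_modeDecay
    ⟨v₀, a, R, t, ha, ht, hv₀m, ⟨M₀, hM₀⟩, hv₀, hdiv, fun τ hτ => ?_, hinf⟩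
  obtain ⟨C', ρ', hρ0', hρ1', hb⟩ := hU τ hτ
  exact exists_modeDecay_of_coeffBound hv₀m hv₀ hM₀ hτ.1 hρ0' hρ1' hb

open LiSinai in
/-- **The catalogued barrier from §10's hypotheses**: under the hypotheses of
`LiSinaiSeriesEnergyBlowup.of_coeffProfile` (Theorem-1-type profile of Li–Sinai's coefficients
for one admissible incompressible datum near the critical time, and sub-criticality before it),
`ComplexNavierStokesBlowup` holds — via `LiSinaiSeriesEnergyBlowup.complexNavierStokesBlowup`
(series solves (1) at all times, Fatou). With these hypotheses PROVED for Li–Sinai's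
10-parameter data (39) this would be `ComplexNavierStokesBlowup_holds`; they are Theorem 1 of the
source (renormalisation group, computer-assisted steps §7 p. 295, p. 302) and are not proved in
the tree. [cite: LiSinai2008, Thm. 1 p. 311 and §10 p. 312] -/
theorem ComplexNavierStokesBlowup.of_coeffProfile
    {v₀ : EuclideanSpace ℝ (Fin 3) → EuclideanSpace ℝ (Fin 3)} {a R M₀ : ℝ} (ha : 0 < a)
    (hv₀m : Measurable v₀) (hv₀ : ∀ k, v₀ k ≠ 0 → a ≤ k 2 ∧ ‖k‖ ≤ R) (hM₀ : ∀ k, ‖v₀ k‖ ≤ M₀)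
    (hdiv : ∀ k, ⟪v₀ k, k⟫ = 0)
    {t η : ℝ} (hη : 0 < η) (hηt : η ≤ t) (e : EuclideanSpace ℝ (Fin 3))
    {G : Set (EuclideanSpace ℝ (Fin 3))} (hG : MeasurableSet G)
    {Core : ℕ → Set (EuclideanSpace ℝ (Fin 3))} (hCm : ∀ p, MeasurableSet (Core p))
    {pstar : ℕ} {c c₀ c₁ κ : ℝ} (hp2 : 2 ≤ pstar) (hc : 0 < c) (hc₀ : 0 < c₀) (hc₁ : 0 < c₁)
    (hκ : 0 < κ)
    (hCoreG : ∀ p, pstar ≤ p → Core p ⊆ G)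
    (hCoreNorm : ∀ p, pstar ≤ p → ∀ k ∈ Core p, c₀ * p ≤ ‖k‖ ∧ ‖k‖ ≤ c₁ * p)
    (hCoreVol : ∀ p, pstar ≤ p → ENNReal.ofReal (κ * p) ≤ volume (Core p))
    (hU : ∀ τ ∈ Ico 0 t, ∃ C ρ : ℝ, 0 ≤ ρ ∧ ρ < 1 ∧
      ∀ p, ∀ s ∈ Icc 0 τ, ∀ k, ‖coeff v₀ p s k‖ ≤ C * ρ ^ p)
    (hSign : ∀ p, pstar ≤ p → ∀ s ∈ Icc (t - η) t, ∀ k ∈ G, ⟪e, coeff v₀ p s k⟫ ≤ 0)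
    (hLower : ∀ p, pstar ≤ p → ∀ k ∈ Core p, ∀ s ∈ Icc (t - η) t, t - (‖k‖ ^ 2)⁻¹ ≤ s →
      ⟪e, coeff v₀ p s k⟫ ≤ -(c * p)) :
    ComplexNavierStokesBlowup :=
  (LiSinaiSeriesEnergyBlowup.of_coeffProfile ha hv₀m hv₀ hM₀ hdiv hη hηt e hG hCm hp2 hc hc₀ hc₁
    hκ hCoreG hCoreNorm hCoreVol hU hSign hLower).complexNavierStokesBlowup


open LiSinai in
/-- **The barrier from Theorem 1 (a₁) on Li–Sinai's own windows.** Let `v₀` be an admissible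
incompressible datum (the `t`-critical datum `Λ(t)⁻¹ v(k, 0)` of §10, amplitude absorbed),
`k₀ > 0` the vertical centre scale (`κ⁽⁰⁾ = (0, 0, k⁽⁰⁾)`, p. 270), `t ≥ η > 0`, `p* ≥ 2` with
`p* k₀ ≥ 4`, `c > 0`, `e` a direction (for the source: `e = e₁`, `c = Z₋ e⁻³`, say). Assume
(U) for every `τ < t` geometric bounds `‖g_p(k,s)‖ ≤ C_τ ρ_τ^p`, `ρ_τ < 1`, on `[0, τ]`
    ("`Λ(t') < Λ(t)`", §10 second paragraph — for the `t`-critical datum, which Theorem 1 with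
    its `s`-dependent parameters `b(s)` does not literally provide: the audited caveat);
(S) for `p ≥ p*`, `s ∈ [t - η, t]` and `k` in the union of the windows `lsCore k₀ q`, `q ≥ p*`:
    `⟨e, g_p(k, s)⟩ ≤ 0` (from (a₁) where it applies: `g̃_p = pZΛ^p e^{-|Y|²/2}(-2Y₁ + δ₁⁽ᵖ⁾,
    …)` and `Y₁ = k₁/√(p k₀)` is bounded below on the windows at the orders `p` present there,
    `sq_apply_zero_ge_of_mem_lsCore`, so the sign is that of `-2Y₁` once `sup|δ₁⁽ᵖ⁾|` is small;
    at orders `p` for which `k` lies outside the domain `|Y| ≤ D₁√(p k⁽⁰⁾)` of (a₁) the source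
    prints only the unsigned bound (a₂) p. 312, so (S) is what the sentence "this immediately
    implies that at `t` the energy is infinite" USES rather than a literal quotation);
(L) for `p ≥ p*`, `k ∈ lsCore k₀ p` and `s ∈ [t - η, t] ∩ [t - 1/|k|², t]`:
    `⟨e, g_p(k, s)⟩ ≤ -c p` ("takes values `O(p)`", (a₁) with `Y₁ ∈ [1, 2]`, `|Y| ≤ √6`,
    `Λ(s)^p/Λ(t)^p → 1` on that window since `t - s ≤ 4/(p k₀)²`).
Then `ComplexNavierStokesBlowup` holds (and `LiSinaiSeriesEnergyBlowup`, see the proof): the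
geometric hypotheses of `ComplexNavierStokesBlowup.of_coeffProfile` are discharged by
`measurableSet_lsCore`, `norm_bounds_of_mem_lsCore` (`c₀ = k₀/2`, `c₁ = k₀ + 4√k₀`) and
`le_volume_lsCore` (`κ = 4k₀√k₀`). (U), (S), (L) are the printed use of Theorem 1 in §10 and are
not proved in the tree. [cite: LiSinai2008, Thm. 1 p. 311 and §10 p. 312] -/
theorem ComplexNavierStokesBlowup.of_liSinaiWindows
    {v₀ : EuclideanSpace ℝ (Fin 3) → EuclideanSpace ℝ (Fin 3)} {a R M₀ : ℝ} (ha : 0 < a)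
    (hv₀m : Measurable v₀) (hv₀ : ∀ k, v₀ k ≠ 0 → a ≤ k 2 ∧ ‖k‖ ≤ R) (hM₀ : ∀ k, ‖v₀ k‖ ≤ M₀)
    (hdiv : ∀ k, ⟪v₀ k, k⟫ = 0) {k₀ : ℝ} (hk₀ : 0 < k₀)
    {t η : ℝ} (hη : 0 < η) (hηt : η ≤ t) (e : EuclideanSpace ℝ (Fin 3))
    {pstar : ℕ} {c : ℝ} (hp2 : 2 ≤ pstar) (hp4 : 4 ≤ (pstar : ℝ) * k₀) (hc : 0 < c)
    (hU : ∀ τ ∈ Ico 0 t, ∃ C ρ : ℝ, 0 ≤ ρ ∧ ρ < 1 ∧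
      ∀ p, ∀ s ∈ Icc 0 τ, ∀ k, ‖coeff v₀ p s k‖ ≤ C * ρ ^ p)
    (hSign : ∀ p, pstar ≤ p → ∀ s ∈ Icc (t - η) t, ∀ q, pstar ≤ q → ∀ k ∈ lsCore k₀ q,
      ⟪e, coeff v₀ p s k⟫ ≤ 0)
    (hLower : ∀ p, pstar ≤ p → ∀ k ∈ lsCore k₀ p, ∀ s ∈ Icc (t - η) t, t - (‖k‖ ^ 2)⁻¹ ≤ s →
      ⟪e, coeff v₀ p s k⟫ ≤ -(c * p)) :
    ComplexNavierStokesBlowup := by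
  set G : Set (EuclideanSpace ℝ (Fin 3)) := ⋃ q, ⋃ (_ : pstar ≤ q), lsCore k₀ q with hG
  have hGm : MeasurableSet G :=
    MeasurableSet.iUnion fun q => MeasurableSet.iUnion fun _ => measurableSet_lsCore k₀ q
  have hCoreG : ∀ p, pstar ≤ p → lsCore k₀ p ⊆ G := fun p hp k hk =>
    Set.mem_iUnion₂.2 ⟨p, hp, hk⟩
  have hp1 : ∀ p, pstar ≤ p → 1 ≤ p := fun p hp => le_trans (by omega) hp
  have hp4' : ∀ p, pstar ≤ p → 4 ≤ (p : ℝ) * k₀ := fun p hp =>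
    hp4.trans (mul_le_mul_of_nonneg_right (by exact_mod_cast hp) hk₀.le)
  have hCoreNorm : ∀ p, pstar ≤ p → ∀ k ∈ lsCore k₀ p,
      k₀ / 2 * p ≤ ‖k‖ ∧ ‖k‖ ≤ (k₀ + 4 * Real.sqrt k₀) * p := fun p hp k hk =>
    norm_bounds_of_mem_lsCore hk₀ (hp1 p hp) (hp4' p hp) hk
  have hCoreVol : ∀ p, pstar ≤ p →
      ENNReal.ofReal (4 * k₀ * Real.sqrt k₀ * p) ≤ volume (lsCore k₀ p) := fun p hp =>
    le_volume_lsCore hk₀.le (hp1 p hp)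
  have hSign' : ∀ p, pstar ≤ p → ∀ s ∈ Icc (t - η) t, ∀ k ∈ G, ⟪e, coeff v₀ p s k⟫ ≤ 0 := by
    intro p hp s hs k hk
    obtain ⟨q, hq, hkq⟩ := Set.mem_iUnion₂.1 hk
    exact hSign p hp s hs q hq k hkq
  exact ComplexNavierStokesBlowup.of_coeffProfile ha hv₀m hv₀ hM₀ hdiv hη hηt e hGm
    (fun p => measurableSet_lsCore k₀ p) hp2 hc (half_pos hk₀) (by positivity) (by positivity)
    hCoreG hCoreNorm hCoreVol hU hSign' hLower

end Literature.Barriers.NavierStokesRegularity
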